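import Literature.MathematicalPhysics.QuantumFieldTheory.Balaban1983to89.Beta.WindowInterface
import Literature.MathematicalPhysics.QuantumFieldTheory.Balaban1983to89.Beta.OneShotTelescope
import Literature.MathematicalPhysics.QuantumFieldTheory.Balaban1983to89.Beta.DriftRemainder

/-!
# `Balaban1983to89.Beta.ComposedRoad` — the COMPOSED (§8 / «V22») organisation of the β sub-cell's wall as ONE kernel
declaration: a k = 0 window decomposition at blocking factor `n = L^m` + [H-germ] in the print's shape ⟹ drift ⟹ END

HONEST FRAMING (cell rule, verbatim): discharging `BetaPertH` makes Bałaban's UV stability UNCONDITIONAL — a real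
constructive-QFT result; it is NOT the continuum limit and NOT the Clay problem.  (Gloss, BETA-SPEC v1.8d/v1.9b
l. 17–18, GAPS G-ref2-14 (a) / G-ref2-20 (a), verbatim: «UNCONDITIONAL» in [Balaban1989LargeFieldII] (B16) p. 355's
interval-hypothesis sense ONLY (`FlowStepRuns.p355Unconditional_of_partialSums` keeps `hnodes`); the located leaves
G-adv3-2 (left inequality of (0.1)/(2.50), d = 4), G-adv3-1 (U2 transfer of B14 Cor. 3's lower bound) and `SecondExpLeaf`
REMAIN.  Gloss 2, BETA-SPEC v1.9e, beta-ref C-beta-78, BINDING: «unconditional» = `Beta.Assembly.EventualForm`-unconditional END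
statement, NOT «Theorem 2 as printed»; Gloss 3 (PROPOSED, BETA-SPEC §7.16/§7.17, awaiting beta-ref): on this road
«unconditional» = `FlowStepRuns.BetaPartialSumsLowerH`-unconditional END statement.)  THIS MODULE DISCHARGES NOTHING of the
series and asserts nothing about Bałaban's β-functions: every input below is a HYPOTHESIS on abstract real families, every
declaration is `[folklore]`.  Value = the wall restated as one theorem (audit cell `pub-balaban`, β sub-cell lead, unit
`b2b-balaban-strat-b12` gen 6, RULING (R10)), NOT summit progress.

WHAT THIS MODULE IS.  BETA-SPEC §8 (v1.3–v1.5) organised the one-loop input of [B12] Theorem 2 through the COMPOSED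
functional: «(H1) ∧ (H2) ∧ [H-germ] ⇒ (T-drift) ⇒ END via `Beta.Drift`».  Gens 4–6 built the window machinery
(`DyadicShell`/`WindowLog`/`LargeLWindow`/`BubbleTransfer`/`WindowInterface`, free legs `TwoPowerLegs`/`FreeHessianLeg`,
`WoodburyFibre`, …) for the PER-STEP road.  This file plugs that machinery into §8's road at `k = 0` (journal CORRECTION OF
RECORD 2026-08-19 00:08Z; `OneShotTelescope` v1.1/v1.2):
* §1 `logGrowth_stepBal`: a window decomposition with the Bałaban-normalised leading kernel and a window cut-off `M(L) ≤ L`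
  gives the TWO-SIDED one-step law `|β0 L k − stepBal N L| ≤ A` (`LargeLWindow.TwoSided.logGrowth` + the certified value).
* §2 `oneLoopDrift_of_composedWindow`: for a FIRST-STEP family `B : ℕ → ℝ` (the marginal coefficient of the composed
  functional with blocking factor `n`, read on the bare lattice) admitting such a decomposition, the composed law along
  `n = L^m` plus [H-germ] in the PRINT's shape (`MarginalTelescoping.SeparationRate C θ`: the old-term defects are
  `≤ Cθ^{m−j}`, [B12] p. 290 (4.35)–(4.36), p. 292 l. 2–9 — HYPOTHESIS) give `Drift.OneLoopDrift (stepBal N L) (A + Cθ/(1−θ)) β⁰`.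
* §3 the END statements (`endpointExistence_of_composedWindow`, `p355Unconditional_of_composedWindow`) with (AF-1) in
  `Drift`'s shape and `C_r γ₀ ≤ stepBal N L`.
* §4 THE WALL AS ONE DECLARATION at LEG level: `oneLoopDrift_of_composedLegInterface` / `endpointExistence_of_composedLegInterface`
  — the hypotheses of `WindowInterface.windowDecomposition_of_legSplitInterface` instantiated at `k = 0` with the blocking
  factor as the running variable ((W1)₀ table, (W2′)₀ window corrections `R_a/(‖w‖^{a−2}n²)`, (W3a)₀ leg tails, (W3b)₀
  identification) + `SeparationRate` + (AF-1).  NO `L → ∞`, NO `(L,k)`-free constant, NO sign of any single `β⁰_{k+1}`.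
* §5 (v1.1) RELATIVISATION: the k = 0 window hypotheses are needed only along ADMISSIBLE blocking factors `Adm ∋ L^m`
  (`oneLoopDrift_of_composedLegInterfaceOn`, `endpointExistence_of_composedLegInterfaceOn`; families without the dummy `k`; table
  legs frozen at `k = 0` by `legAtZero`; the non-admissible `n` are filled by a harmless junk extension inside the proof).
* §6 (v1.2) the END statements with the remainder in the PRINTED CONSTANT FORM `RemainderChain.RemainderConst S γ₀ r`,
  `r ≤ stepBal N L` (row an4's `Beta.DriftRemainder` p181429; the block was kernel-checked by row BETA-an4 gen 5 as a snippet
  and is pasted here by the lead per RULING (R10) §7.17 (d)(iv)) — window level, leg level relativised, and with the printed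
  chain (`ε₁·K_rem ≤ stepBal N Lc`).  The Lipschitz (AF-1) slot of §3–§5 is the stronger special case
  (`DriftRemainder.Witness.not_af1`).  CONSUMER NOTE (co-lead, `Beta/ConstRemainderConsumers` p181575): `r ≤ b` buys
  (A-ps) / EndpointExistence / the p. 355 reading; the [III]-side consumer (2.46) needs `r < b` STRICTLY.
* §7 (v1.2) the EXACT-IDENTITY instance of [H-germ′]: under `MarginalTelescoping.IdentityForm μC β⁰` (defect ZERO — the
  shape certified at the abstract level by `Beta/StrangFixMoment` (unit b2b-balaban-b12-g9: Strang–Fix moment identity,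
  `identityForm_of_stepInvariant`) and `Beta/DecimatedMoment` (row an2 gen 4: two-sided non-commutative master identity))
  `SeparationRate 0 θ` is automatic (`separationRate_zero_of_identityForm`) and the drift constant loses the `Cθ/(1−θ)`
  term: `oneLoopDrift_of_composedWindow_identity`, `oneLoopDrift_of_composedLegInterfaceOn_identity`,
  `endpointExistence_of_composedLegInterfaceOn_identity_remainderConst`.  Whether Bałaban's carried terms instantiate
  `IdentityForm` exactly (typing (D-a)) or only `SeparationRate C θ` (print's bookkeeping (A)) is row an2's certificate
  (`HOME/BETA/AN2.md` §11), NOT decided here.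
* §8 (v1.3) THE WALL WITHOUT `B` AND WITHOUT `hcomp` (RULING (R11) item (O2) DISSOLVED, BETA-SPEC §7.19): on the primary road the only values
  of the first-step family ever read are `B (Lc^m)`, and under typing (D-a) these ARE the composed coefficients `composedCoeff μC m` (the marginal
  coefficient of the order-zero part `Σ_{j<m}[log Z^{(j)}(U_m ·) − log Z^{(j)}(1)]` of [B12] (1.3) p. 260 — by the DEFINITION `composedCoeff μC m =
  Σ_{j<m} μC j m` and linearity of the (1.22)-moment; no analytic content).  So the window hypotheses are stated DIRECTLY for `composedCoeff μC m`
  along `n = Lc^m` (`oneLoopDrift_of_composedLegInterfacePow`, `…Pow_identity`, `endpointExistence_of_composedLegInterfacePow_identity_remainderConst`):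
  the identification of the composed coefficient with a leg-table window sum is the (W3b)₀ binder `hident` itself — whichever representation of its
  integrand a row uses (composed m-layer objects = [B4]'s fixed-L class; covariant-gauge legs via Ward, RULING (R7); one-shot big-block objects via a
  Faddeev–Popov/semigroup transfer, GAPS G-B5-01 / G-adv2-30 (ii)) is that row's `hident` obligation, not an extra hypothesis of the wall.
* §9 (v1.4) DISTANCE-FORM ADAPTERS for the rows' leg certificates (model-free, over `Pt`): a bound `R′/T^a·e^{−c·T}` (resp. `S′/T^a`) in
  ANY «distance» `T ≥ ‖w‖_∞` (torus distance in fine units, Euclidean or ℓ¹ norm — the shape of an1-g5's `Beta/SliceLegs` §4 and of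
  pv23-g4's `TransportLeg`) implies the shell binders `hFtail`/`hGtail` of §4/§5/§8 on `annulus 4 r (r+1)` VERBATIM (`shellBound_of_distExp`,
  `shellBound_of_distPow`, family forms `tailExp_of_distFamily`, `tailPow_of_distFamily`); and a scale bound `D/n^a` on the whole lattice
  implies the window binders `hF`/`hG` (`window_of_scaleFamily`, via `WindowInterface.windowBound_of_scaleBound`; the shape of an5's
  `WoodburyFibre`/`WoodburyCovariant` remainders).  No second passage through `shellBound_of_scaleExp` (no `a!(2/δ)^a`, no halved rate).
* §10 (v1.5, RULING (R13-3), BETA-SPEC §7.24) BASE-POINT-AVERAGED IDENTIFICATION: the one-shot entries at blocking factor `n` are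
  `n`-block-periodic jointly, not fine-translation invariant (an3-g6, `Beta/SquareTable` v1.3 §10), so the leg families are read PER BASE
  POINT `b` (`F′ b i n w` = entry at `(b + w, b)`), the (W2′)₀/(W3a)₀ certificates are required for every `b ∈ Bset n` with `b`-free
  constants, and `hident` compares `composedCoeff μC m` with a CONVEX COMBINATION (weights `wt n b`, e.g. the block average) of the
  single-base-point window sums — `windowDecomposition_of_avgLegSplitInterface`, `oneLoopDrift_of_composedLegInterfacePow_identity_avg`,
  `endpointExistence_of_composedLegInterfacePow_identity_avg_remainderConst`; SAME conclusion and SAME constant as §8 (convexity of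
  `WindowInterface.inWindow_of_legPerturbation` / `shellBound_of_legDecay`); §8's `hident` is the one-point case.
What is NOT here: any instance of these hypotheses for Bałaban's objects (the located, unprinted content: BETA-SPEC §7.16–§7.20,
MISSING-B12 Census; GAPS G-sb12-4′ for (W3a)₀).  Reader's pointer (XREAD C-adv2-40 R1 / G-adv2-30 (c2)): for the composed
family the identification of `B n` with Bałaban's first-step coefficient lives inside the (W2′)₀/(W3b)₀ hypotheses (`hF`,
`hG`, `hident`), not in `hcomp`, which only records `composedCoeff μC m = B (L^m)`.

v1.1 (APPEND-ONLY; §1–§4 byte-identical to v1 p181424): §5 relativisation to admissible blocking factors.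
v1.2 (APPEND-ONLY; §1–§5 byte-identical to v1.1 p181477; one extra import `Beta.DriftRemainder`): §6 constant-form remainder
consumers (row an4's snippet), §7 the `IdentityForm` (C = 0) instance.
v1.3 (APPEND-ONLY; §1–§7 byte-identical to v1.2 p181596; no new import): §8 the wall stated for `composedCoeff μC m` along `n = Lc^m` directly
(no `B`, no `hcomp`).
v1.4 (APPEND-ONLY; §1–§8 byte-identical to v1.3 p181730; no new import): §9 distance-form / scale-form adapters for the leg binders.
v1.5 (APPEND-ONLY; §1–§9 byte-identical to v1.4 p181814; no new import): §10 base-point-averaged identification (RULING (R13-3)).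

References (CONTEXT ONLY; nothing cited as a fact): [B12] T. Bałaban, CMP 109 (1987) 249–301, (0.17)/(0.19) p. 255,
(1.3)–(1.4) p. 260, (1.20)–(1.22) p. 264, (4.35)–(4.36) p. 290, p. 292 l. 2–9, Thm 2 p. 259; [B16] CMP 122 (1989) p. 355.
-/

namespace Literature.MathematicalPhysics.QuantumFieldTheory.Balaban1983to89.Beta.ComposedRoad

open Finset
open Literature.Probability.LatticeModels (annulus)
open Literature.MathematicalPhysics.QuantumFieldTheory.Balaban1983to89
open FlowStep FlowStepRuns DagBinding
open Literature.MathematicalPhysics.QuantumFieldTheory.Balaban1983to89.Beta.TransverseStructure (E4)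
open Literature.MathematicalPhysics.QuantumFieldTheory.Balaban1983to89.Beta.LeadingCoefficient (leadingIntegrand kappaBal
  transverseValue unitCoeff dyadicRate_leadingIntegrand kappaBal_pos transverseValue_pos slope_kappaBal)
open Literature.MathematicalPhysics.QuantumFieldTheory.Balaban1983to89.Beta.DyadicShell (Pt toReal supNorm)
open Literature.MathematicalPhysics.QuantumFieldTheory.Balaban1983to89.Beta.LargeLWindow (WindowDecomposition)
open Literature.MathematicalPhysics.QuantumFieldTheory.Balaban1983to89.Beta.LargeLWindow.WindowDecomposition (constA)
open Literature.MathematicalPhysics.QuantumFieldTheory.Balaban1983to89.Beta.LargeL (LogGrowth)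
open Literature.MathematicalPhysics.QuantumFieldTheory.Balaban1983to89.Beta.BubbleTransfer (Leg contBubble bubbleConst)
open Literature.MathematicalPhysics.QuantumFieldTheory.Balaban1983to89.Beta.Drift (OneLoopDrift betaPartialSumsLowerH_of_drift
  endpointExistence_of_drift p355Unconditional_of_drift)
open Literature.MathematicalPhysics.QuantumFieldTheory.Balaban1983to89.Beta.MarginalTelescoping (composedCoeff SeparationRate)
open Literature.MathematicalPhysics.QuantumFieldTheory.Balaban1983to89.Beta.OneShotTelescope (oneLoopDrift_of_composedLaw')

/-! ## 1. The two-sided one-step law with the certified value -/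

section Value

variable {β0 : ℕ → ℕ → ℝ} {Ch Cg A₁ c : ℝ} {M : ℕ → ℕ} {N : ℝ} {μ ν : Fin 4}

/-- **TWO-SIDED (AF-0-L) WITH THE BAŁABAN SLOPE.**  A window decomposition with leading kernel `kappaBal N · T` and a
cut-off `M(L) ≤ L` gives `LogGrowth β0 (κ·transverseValue/log 2) A` — i.e. `|β0 L k − stepBal N L| ≤ A` (`abs_sub_stepBal_le`),
`A = constA Ch Cg A₁ c (κ·transverseValue)`. [folklore] -/
theorem logGrowth_stepBal
    (W : WindowDecomposition β0 (fun w => leadingIntegrand (kappaBal N) μ ν (toReal w)) Ch Cg A₁ c M) (hN : N ≠ 0)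
    (hμν : μ ≠ ν) (hML : ∀ L : ℕ, 2 ≤ L → M L ≤ L) :
    LogGrowth β0 (kappaBal N * transverseValue / Real.log 2) (constA Ch Cg A₁ c (kappaBal N * transverseValue)) := by
  have hI := dyadicRate_leadingIntegrand (kappaBal N) μ ν
  rw [ShellValue.unitCoeff_eq_transverseValue hμν] at hI
  exact LargeLWindow.TwoSided.logGrowth W hI (mul_nonneg (kappaBal_pos hN).le transverseValue_pos.le) hML

/-- The same as `|β0 L k − stepBal N L| ≤ A`. [folklore] -/
theorem abs_sub_stepBal_le
    (W : WindowDecomposition β0 (fun w => leadingIntegrand (kappaBal N) μ ν (toReal w)) Ch Cg A₁ c M) (hN : N ≠ 0)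
    (hμν : μ ≠ ν) (hML : ∀ L : ℕ, 2 ≤ L → M L ≤ L) :
    ∀ L : ℕ, 2 ≤ L → ∀ k : ℕ,
      |β0 L k - B12Normalization.stepBal N L| ≤ constA Ch Cg A₁ c (kappaBal N * transverseValue) := by
  intro L hL k
  have h := logGrowth_stepBal W hN hμν hML L hL k
  rwa [slope_kappaBal] at h

end Value

/-! ## 2. The composed road at the level of a window decomposition for the FIRST-STEP family -/

section Composed

variable {β : HBeta} {B : ℕ → ℝ} {μC : ℕ → ℕ → ℝ} {Ch Cg A₁ c : ℝ} {M : ℕ → ℕ} {N : ℝ} {μ ν : Fin 4} {L : ℕ} {C θ : ℝ}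

/-- **COMPOSED TWO-SIDED LAW + [H-germ] ⟹ DRIFT WITH SLOPE `stepBal N L`.**  If the first-step family `B` (as the
`k`-independent family `fun n _ => B n`) admits a window decomposition with the Bałaban leading kernel and `M(n) ≤ n`, the
composed marginal coefficient is `B` along the powers (`composedCoeff μC m = B (L^m)`), and the old-term defects obey
`SeparationRate C θ μC β⁰`, then `OneLoopDrift (stepBal N L) (A + Cθ/(1−θ)) β⁰`, `A = constA …`. [folklore] -/
theorem oneLoopDrift_of_composedWindow (S : B12Beta.OneLoopSplit β)
    (W : WindowDecomposition (fun n _ => B n) (fun w => leadingIntegrand (kappaBal N) μ ν (toReal w)) Ch Cg A₁ c M)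
    (hN : N ≠ 0) (hμν : μ ≠ ν) (hML : ∀ L : ℕ, 2 ≤ L → M L ≤ L) (hL : 2 ≤ L) (hC : 0 ≤ C) (hθ0 : 0 ≤ θ) (hθ1 : θ < 1)
    (hsep : SeparationRate C θ μC S.β0) (hcomp : ∀ m : ℕ, composedCoeff μC m = B (L ^ m)) :
    OneLoopDrift (B12Normalization.stepBal N L)
      (constA Ch Cg A₁ c (kappaBal N * transverseValue) + C * θ / (1 - θ)) S.β0 := by
  have hlg := logGrowth_stepBal W hN hμν hML
  have hBn : ∀ n : ℕ, 2 ≤ n →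
      |B n - kappaBal N * transverseValue / Real.log 2 * Real.log n| ≤ constA Ch Cg A₁ c (kappaBal N * transverseValue) :=
    fun n hn => hlg n hn 0
  have hA : 0 ≤ constA Ch Cg A₁ c (kappaBal N * transverseValue) := (abs_nonneg _).trans (hBn 2 le_rfl)
  have h := oneLoopDrift_of_composedLaw' hL hA hC hθ0 hθ1 hsep hcomp hBn
  rwa [slope_kappaBal] at h

/-! ## 3. The END statements on the composed road -/

/-- **(A-ps) ON THE COMPOSED ROAD**: §2 + (AF-1) `|β¹_k p| ≤ C_r·p(last)` on `HistBox γ₀` with `C_rγ₀ ≤ stepBal N L` ⟹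
`BetaPartialSumsLowerH (2(A + Cθ/(1−θ))) γ₀ β`. [folklore] -/
theorem betaPartialSumsLowerH_of_composedWindow (S : B12Beta.OneLoopSplit β)
    (W : WindowDecomposition (fun n _ => B n) (fun w => leadingIntegrand (kappaBal N) μ ν (toReal w)) Ch Cg A₁ c M)
    (hN : N ≠ 0) (hμν : μ ≠ ν) (hML : ∀ L : ℕ, 2 ≤ L → M L ≤ L) (hL : 2 ≤ L) (hC : 0 ≤ C) (hθ0 : 0 ≤ θ) (hθ1 : θ < 1)
    (hsep : SeparationRate C θ μC S.β0) (hcomp : ∀ m : ℕ, composedCoeff μC m = B (L ^ m)) {Cr γ₀ : ℝ}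
    (hAF1 : ∀ k (p : Fin (k + 1) → ℝ), p ∈ B12Beta.HistBox γ₀ k → |S.β1 k p| ≤ Cr * p (Fin.last k))
    (hCr : 0 ≤ Cr) (hγ : Cr * γ₀ ≤ B12Normalization.stepBal N L) :
    BetaPartialSumsLowerH (2 * (constA Ch Cg A₁ c (kappaBal N * transverseValue) + C * θ / (1 - θ))) γ₀ β :=
  betaPartialSumsLowerH_of_drift S (oneLoopDrift_of_composedWindow S W hN hμν hML hL hC hθ0 hθ1 hsep hcomp) hAF1 hCr hγ

/-- **ENDPOINT EXISTENCE ON THE COMPOSED ROAD** ([B12] Thm 2, first sentence, forward-generated constructions).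
[folklore] -/
theorem endpointExistence_of_composedWindow {Cc : B12.Construction} (hgen : ForwardGenerated Cc β)
    (S : B12Beta.OneLoopSplit β)
    (W : WindowDecomposition (fun n _ => B n) (fun w => leadingIntegrand (kappaBal N) μ ν (toReal w)) Ch Cg A₁ c M)
    (hN : N ≠ 0) (hμν : μ ≠ ν) (hML : ∀ L : ℕ, 2 ≤ L → M L ≤ L) (hL : 2 ≤ L) (hC : 0 ≤ C) (hθ0 : 0 ≤ θ) (hθ1 : θ < 1)
    (hsep : SeparationRate C θ μC S.β0) (hcomp : ∀ m : ℕ, composedCoeff μC m = B (L ^ m)) {Cr γ₀ β' : ℝ}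
    (hγ₀ : 0 < γ₀)
    (hAF1 : ∀ k (p : Fin (k + 1) → ℝ), p ∈ B12Beta.HistBox γ₀ k → |S.β1 k p| ≤ Cr * p (Fin.last k))
    (hCr : 0 ≤ Cr) (hγ : Cr * γ₀ ≤ B12Normalization.stepBal N L) (hβ' : 0 ≤ β') (hcont : BetaContH γ₀ β)
    (hup : BetaUpperH β' γ₀ β) : EndpointExistence Cc :=
  endpointExistence_of_drift hgen S hγ₀ (oneLoopDrift_of_composedWindow S W hN hμν hML hL hC hθ0 hθ1 hsep hcomp)
    hAF1 hCr hγ hβ' hcont hup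

/-- **THE p. 355 «UNCONDITIONAL» READING ON THE COMPOSED ROAD** (B16 p. 355; keeps `hnodes`). [folklore] -/
theorem p355Unconditional_of_composedWindow (w : World) (hγw : 0 < w.γ) {γ₀ : ℝ} (hγ₀ : w.γ ≤ γ₀)
    (hβup : 0 ≤ w.βup) (hnodes : ∀ P, Nodes (leaves w P))
    (hgen : ForwardGenerated w.C.toB12 β) (hhalt : HaltsOutside w.C.toB12 β) (hcur : CurriesHBeta w.C.toB12 β)
    (hcont : BetaContH γ₀ β) (hup : BetaUpperH w.βup γ₀ β) (S : B12Beta.OneLoopSplit β)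
    (W : WindowDecomposition (fun n _ => B n) (fun w => leadingIntegrand (kappaBal N) μ ν (toReal w)) Ch Cg A₁ c M)
    (hN : N ≠ 0) (hμν : μ ≠ ν) (hML : ∀ L : ℕ, 2 ≤ L → M L ≤ L) (hL : 2 ≤ L) (hC : 0 ≤ C) (hθ0 : 0 ≤ θ) (hθ1 : θ < 1)
    (hsep : SeparationRate C θ μC S.β0) (hcomp : ∀ m : ℕ, composedCoeff μC m = B (L ^ m)) {Cr : ℝ}
    (hAF1 : ∀ k (p : Fin (k + 1) → ℝ), p ∈ B12Beta.HistBox γ₀ k → |S.β1 k p| ≤ Cr * p (Fin.last k))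
    (hCr : 0 ≤ Cr) (hγ : Cr * γ₀ ≤ B12Normalization.stepBal N L)
    (hMγ : 2 * (constA Ch Cg A₁ c (kappaBal N * transverseValue) + C * θ / (1 - θ)) * w.γ ^ 2 ≤ w.β₀ * (2 + w.β₀)) :
    B16.Sect2Unconditional w.C ∧
      ∃ Em Ep : ℝ, ∀ m : ℕ, ∃ gstar : ℝ, 0 < gstar ∧ ∀ g : ℝ, 0 < g → g ≤ gstar →
        ∀ K : ℕ, ∃ g0 : ℝ, (w.C ⟨K, m, g0⟩).flow.g K = g ∧
          ∀ k, k ≤ K → ∀ V : (w.C ⟨K, m, g0⟩).Cfg k, B16.UVIneq (w.C ⟨K, m, g0⟩) k V Em Ep :=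
  p355Unconditional_of_drift w hγw hγ₀ hβup hnodes hgen hhalt hcur hcont hup S
    (oneLoopDrift_of_composedWindow S W hN hμν hML hL hC hθ0 hθ1 hsep hcomp) hAF1 hCr hγ hMγ

end Composed

/-! ## 4. THE WALL AS ONE DECLARATION on the composed road: leg-level window hypotheses at `k = 0` + [H-germ] + (AF-1) -/

section LegLevel

variable {ι : Type*} {s : Finset ι} {cc₀ : ι → ℝ} {P Q : ι → Leg}

/-- **THE COMPOSED ROAD, LEG LEVEL ⟹ DRIFT.**  Inputs, all HYPOTHESES on abstract families indexed by the blocking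
factor `n` (the second index of `F′ n k`, `G′ n k` is a dummy): (W1)₀ a degree-6 leg table with continuum moment
`kappaBal N · T` (`hdeg`, `hval`); window comparability (`hM`, `hML`); (W2′)₀ the legs within `R_a/(‖w‖^{a−2} n²)` of the
table on the window (`hF`, `hG`); (W3a)₀ leg tails beyond it (`hFtail` with `e^{−(δ/n)(r+1)}`, `hGtail`); (W3b)₀ the
identification of `B n` with a finite lattice sum of the integrand up to `U` (`hident`); [H-germ] `SeparationRate C θ μC β⁰`
with `composedCoeff μC m = B(L^m)`; ⟹ `OneLoopDrift (stepBal N L) (A + Cθ/(1−θ)) β⁰` with the explicit `A` of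
`WindowInterface.windowDecomposition_of_legSplitInterface`. [folklore] -/
theorem oneLoopDrift_of_composedLegInterface {β : HBeta} (S : B12Beta.OneLoopSplit β)
    (hdeg : ∀ i ∈ s, (P i).a + (Q i).a = 6) {μ ν : Fin 4} (hμν : μ ≠ ν) {N : ℝ} (hN : N ≠ 0)
    (hval : ∀ x : E4, x ≠ 0 → x μ * x ν * contBubble s cc₀ P Q x = leadingIntegrand (kappaBal N) μ ν x)
    {B : ℕ → ℝ} {F' G' : ι → ℕ → ℕ → Pt → ℝ} {R S' R' Sg : ι → ℝ} {δ U cc : ℝ} {M : ℕ → ℕ}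
    (hR : ∀ i ∈ s, 0 ≤ R i) (hS : ∀ i ∈ s, 0 ≤ Sg i) (hR' : ∀ i ∈ s, 0 ≤ R' i) (hS' : ∀ i ∈ s, 0 ≤ S' i) (hδ : 0 < δ)
    (hc : 1 ≤ cc) (hM : ∀ L : ℕ, 2 ≤ L → 1 ≤ M L ∧ (L : ℝ) ≤ cc * M L) (hML : ∀ L : ℕ, 2 ≤ L → M L ≤ L)
    (hF : ∀ L : ℕ, 2 ≤ L → ∀ k : ℕ, ∀ w ∈ annulus 4 0 (M L), ∀ i ∈ s,
      |F' i L k w - (P i).f L k w| ≤ R i / ((supNorm w : ℝ) ^ ((P i).a - 2) * (L : ℝ) ^ 2))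
    (hG : ∀ L : ℕ, 2 ≤ L → ∀ k : ℕ, ∀ w ∈ annulus 4 0 (M L), ∀ i ∈ s,
      |G' i L k w - (Q i).f L k w| ≤ Sg i / ((supNorm w : ℝ) ^ ((Q i).a - 2) * (L : ℝ) ^ 2))
    (hFtail : ∀ L : ℕ, 2 ≤ L → ∀ k : ℕ, ∀ r : ℕ, M L ≤ r → ∀ w ∈ annulus 4 r (r + 1), ∀ i ∈ s,
      |F' i L k w| ≤ R' i / ((r : ℝ) + 1) ^ (P i).a * Real.exp (-(δ / L) * ((r : ℝ) + 1)))
    (hGtail : ∀ L : ℕ, 2 ≤ L → ∀ k : ℕ, ∀ r : ℕ, M L ≤ r → ∀ w ∈ annulus 4 r (r + 1), ∀ i ∈ s,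
      |G' i L k w| ≤ S' i / ((r : ℝ) + 1) ^ (Q i).a)
    (hident : ∀ L : ℕ, 2 ≤ L → ∀ k : ℕ, ∃ R₀ : ℕ, M L ≤ R₀ ∧
      |B L - ∑ w ∈ annulus 4 0 R₀, toReal w μ * toReal w ν * ∑ i ∈ s, cc₀ i * (F' i L k w * G' i L k w)| ≤ U)
    {μC : ℕ → ℕ → ℝ} {Lc : ℕ} {C θ : ℝ} (hL : 2 ≤ Lc) (hC : 0 ≤ C) (hθ0 : 0 ≤ θ) (hθ1 : θ < 1)
    (hsep : SeparationRate C θ μC S.β0) (hcomp : ∀ m : ℕ, composedCoeff μC m = B (Lc ^ m)) :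
    OneLoopDrift (B12Normalization.stepBal N Lc)
      (constA (|kappaBal N| * 24 + |kappaBal N| * 110592) (bubbleConst s cc₀ P Q)
          ((80 * (∑ i ∈ s, |cc₀ i| * (R' i * S' i)) * (1 + cc / δ) + U) +
            80 * ∑ i ∈ s, |cc₀ i| * ((((P i).A + (P i).B) * Sg i + R i * ((Q i).A + (Q i).B) + R i * Sg i)))
          cc (kappaBal N * transverseValue) + C * θ / (1 - θ)) S.β0 :=
  oneLoopDrift_of_composedWindow S
    (WindowInterface.windowDecomposition_of_legSplitInterface (β0 := fun n _ => B n) hdeg hval hR hS hR' hS' hδ hc hM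
      hML hF hG hFtail hGtail hident)
    hN hμν hML hL hC hθ0 hθ1 hsep hcomp

/-- **THE COMPOSED ROAD, LEG LEVEL ⟹ ENDPOINT EXISTENCE** ([B12] Thm 2 first sentence, forward-generated constructions):
§4's drift + (AF-1) with `C_rγ₀ ≤ stepBal N L` + the printed-type continuity and upper bound. [folklore] -/
theorem endpointExistence_of_composedLegInterface {β : HBeta} {Cn : B12.Construction} (hgen : ForwardGenerated Cn β)
    (S : B12Beta.OneLoopSplit β)
    (hdeg : ∀ i ∈ s, (P i).a + (Q i).a = 6) {μ ν : Fin 4} (hμν : μ ≠ ν) {N : ℝ} (hN : N ≠ 0)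
    (hval : ∀ x : E4, x ≠ 0 → x μ * x ν * contBubble s cc₀ P Q x = leadingIntegrand (kappaBal N) μ ν x)
    {B : ℕ → ℝ} {F' G' : ι → ℕ → ℕ → Pt → ℝ} {R S' R' Sg : ι → ℝ} {δ U cc : ℝ} {M : ℕ → ℕ}
    (hR : ∀ i ∈ s, 0 ≤ R i) (hS : ∀ i ∈ s, 0 ≤ Sg i) (hR' : ∀ i ∈ s, 0 ≤ R' i) (hS' : ∀ i ∈ s, 0 ≤ S' i) (hδ : 0 < δ)
    (hc : 1 ≤ cc) (hM : ∀ L : ℕ, 2 ≤ L → 1 ≤ M L ∧ (L : ℝ) ≤ cc * M L) (hML : ∀ L : ℕ, 2 ≤ L → M L ≤ L)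
    (hF : ∀ L : ℕ, 2 ≤ L → ∀ k : ℕ, ∀ w ∈ annulus 4 0 (M L), ∀ i ∈ s,
      |F' i L k w - (P i).f L k w| ≤ R i / ((supNorm w : ℝ) ^ ((P i).a - 2) * (L : ℝ) ^ 2))
    (hG : ∀ L : ℕ, 2 ≤ L → ∀ k : ℕ, ∀ w ∈ annulus 4 0 (M L), ∀ i ∈ s,
      |G' i L k w - (Q i).f L k w| ≤ Sg i / ((supNorm w : ℝ) ^ ((Q i).a - 2) * (L : ℝ) ^ 2))
    (hFtail : ∀ L : ℕ, 2 ≤ L → ∀ k : ℕ, ∀ r : ℕ, M L ≤ r → ∀ w ∈ annulus 4 r (r + 1), ∀ i ∈ s,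
      |F' i L k w| ≤ R' i / ((r : ℝ) + 1) ^ (P i).a * Real.exp (-(δ / L) * ((r : ℝ) + 1)))
    (hGtail : ∀ L : ℕ, 2 ≤ L → ∀ k : ℕ, ∀ r : ℕ, M L ≤ r → ∀ w ∈ annulus 4 r (r + 1), ∀ i ∈ s,
      |G' i L k w| ≤ S' i / ((r : ℝ) + 1) ^ (Q i).a)
    (hident : ∀ L : ℕ, 2 ≤ L → ∀ k : ℕ, ∃ R₀ : ℕ, M L ≤ R₀ ∧
      |B L - ∑ w ∈ annulus 4 0 R₀, toReal w μ * toReal w ν * ∑ i ∈ s, cc₀ i * (F' i L k w * G' i L k w)| ≤ U)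
    {μC : ℕ → ℕ → ℝ} {Lc : ℕ} {C θ : ℝ} (hL : 2 ≤ Lc) (hC : 0 ≤ C) (hθ0 : 0 ≤ θ) (hθ1 : θ < 1)
    (hsep : SeparationRate C θ μC S.β0) (hcomp : ∀ m : ℕ, composedCoeff μC m = B (Lc ^ m))
    {Cr γ₀ β' : ℝ} (hγ₀ : 0 < γ₀)
    (hAF1 : ∀ k (p : Fin (k + 1) → ℝ), p ∈ B12Beta.HistBox γ₀ k → |S.β1 k p| ≤ Cr * p (Fin.last k))
    (hCr : 0 ≤ Cr) (hγ : Cr * γ₀ ≤ B12Normalization.stepBal N Lc) (hβ' : 0 ≤ β') (hcont : BetaContH γ₀ β)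
    (hup : BetaUpperH β' γ₀ β) : EndpointExistence Cn :=
  endpointExistence_of_drift hgen S hγ₀
    (oneLoopDrift_of_composedLegInterface S hdeg hμν hN hval hR hS hR' hS' hδ hc hM hML hF hG hFtail hGtail hident hL hC
      hθ0 hθ1 hsep hcomp)
    hAF1 hCr hγ hβ' hcont hup

end LegLevel

/-! ## 5. (v1.1) Relativisation to ADMISSIBLE blocking factors (`Adm ∋ L^m`): the composed road only ever reads `n = L^m` -/

section LegLevelOn

variable {ι : Type*} {s : Finset ι} {cc₀ : ι → ℝ} {P Q : ι → Leg}

/-- A `Leg` with its lattice entry frozen at `k = 0` (continuum part, degree and constants unchanged) — on the composed road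
there is no step index. [folklore] -/
def legAtZero (T : Leg) : Leg where
  f := fun L _ w => T.f L 0 w
  ℓ := T.ℓ
  a := T.a
  A := T.A
  B := T.B
  nonneg_A := T.nonneg_A
  nonneg_B := T.nonneg_B
  lead := T.lead
  err := fun L _ w hw => T.err L 0 w hw

/-- Unfolding: the frozen lattice entry. [folklore] -/
@[simp] theorem legAtZero_f (T : Leg) (L k : ℕ) (w : Pt) : (legAtZero T).f L k w = T.f L 0 w := rfl

/-- Unfolding: the degree. [folklore] -/
@[simp] theorem legAtZero_a (T : Leg) : (legAtZero T).a = T.a := rfl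

/-- Unfolding: the size constant. [folklore] -/
@[simp] theorem legAtZero_A (T : Leg) : (legAtZero T).A = T.A := rfl

/-- Unfolding: the error constant. [folklore] -/
@[simp] theorem legAtZero_B (T : Leg) : (legAtZero T).B = T.B := rfl

/-- The continuum bubble does not see the freezing. [folklore] -/
theorem contBubble_legAtZero :
    contBubble s cc₀ (fun i => legAtZero (P i)) (fun i => legAtZero (Q i)) = contBubble s cc₀ P Q := rfl

/-- Nor does the transfer constant. [folklore] -/
theorem bubbleConst_legAtZero :
    bubbleConst s cc₀ (fun i => legAtZero (P i)) (fun i => legAtZero (Q i)) = bubbleConst s cc₀ P Q := rfl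

/-- **THE COMPOSED ROAD, LEG LEVEL, RELATIVISED ⟹ DRIFT.**  As `oneLoopDrift_of_composedLegInterface`, but: the families
`F′ G′ : ι → ℕ → Pt → ℝ` carry no step index, the table legs are read at `k = 0`, and the window hypotheses (W2′)₀ / (W3a)₀ /
(W3b)₀ are assumed ONLY for admissible blocking factors `Adm n` (`n ≥ 2`), where `Adm` contains every power `L^m` (e.g.
`Adm n :↔ ∃ m, n = L^m` — the sub-slicing road (S1)–(S3) of GAPS G-sb12-4′ delivers (W3a)₀ exactly there).  The comparability
of the cut-off `M` is kept for all `n ≥ 2` (the cut-off is the analyst's choice). [folklore] -/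
theorem oneLoopDrift_of_composedLegInterfaceOn {β : HBeta} (S : B12Beta.OneLoopSplit β)
    (hdeg : ∀ i ∈ s, (P i).a + (Q i).a = 6) {μ ν : Fin 4} (hμν : μ ≠ ν) {N : ℝ} (hN : N ≠ 0)
    (hval : ∀ x : E4, x ≠ 0 → x μ * x ν * contBubble s cc₀ P Q x = leadingIntegrand (kappaBal N) μ ν x)
    (Adm : ℕ → Prop) {Lc : ℕ} (hL : 2 ≤ Lc) (hAdm : ∀ m : ℕ, Adm (Lc ^ m))
    {B : ℕ → ℝ} {F' G' : ι → ℕ → Pt → ℝ} {R S' R' Sg : ι → ℝ} {δ U cc : ℝ} {M : ℕ → ℕ}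
    (hR : ∀ i ∈ s, 0 ≤ R i) (hS : ∀ i ∈ s, 0 ≤ Sg i) (hR' : ∀ i ∈ s, 0 ≤ R' i) (hS' : ∀ i ∈ s, 0 ≤ S' i) (hδ : 0 < δ)
    (hc : 1 ≤ cc) (hM : ∀ L : ℕ, 2 ≤ L → 1 ≤ M L ∧ (L : ℝ) ≤ cc * M L) (hML : ∀ L : ℕ, 2 ≤ L → M L ≤ L)
    (hF : ∀ n : ℕ, Adm n → 2 ≤ n → ∀ w ∈ annulus 4 0 (M n), ∀ i ∈ s,
      |F' i n w - (P i).f n 0 w| ≤ R i / ((supNorm w : ℝ) ^ ((P i).a - 2) * (n : ℝ) ^ 2))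
    (hG : ∀ n : ℕ, Adm n → 2 ≤ n → ∀ w ∈ annulus 4 0 (M n), ∀ i ∈ s,
      |G' i n w - (Q i).f n 0 w| ≤ Sg i / ((supNorm w : ℝ) ^ ((Q i).a - 2) * (n : ℝ) ^ 2))
    (hFtail : ∀ n : ℕ, Adm n → 2 ≤ n → ∀ r : ℕ, M n ≤ r → ∀ w ∈ annulus 4 r (r + 1), ∀ i ∈ s,
      |F' i n w| ≤ R' i / ((r : ℝ) + 1) ^ (P i).a * Real.exp (-(δ / n) * ((r : ℝ) + 1)))
    (hGtail : ∀ n : ℕ, Adm n → 2 ≤ n → ∀ r : ℕ, M n ≤ r → ∀ w ∈ annulus 4 r (r + 1), ∀ i ∈ s,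
      |G' i n w| ≤ S' i / ((r : ℝ) + 1) ^ (Q i).a)
    (hident : ∀ n : ℕ, Adm n → 2 ≤ n → ∃ R₀ : ℕ, M n ≤ R₀ ∧
      |B n - ∑ w ∈ annulus 4 0 R₀, toReal w μ * toReal w ν * ∑ i ∈ s, cc₀ i * (F' i n w * G' i n w)| ≤ U)
    {μC : ℕ → ℕ → ℝ} {C θ : ℝ} (hC : 0 ≤ C) (hθ0 : 0 ≤ θ) (hθ1 : θ < 1)
    (hsep : SeparationRate C θ μC S.β0) (hcomp : ∀ m : ℕ, composedCoeff μC m = B (Lc ^ m)) :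
    OneLoopDrift (B12Normalization.stepBal N Lc)
      (constA (|kappaBal N| * 24 + |kappaBal N| * 110592) (bubbleConst s cc₀ P Q)
          ((80 * (∑ i ∈ s, |cc₀ i| * (R' i * S' i)) * (1 + cc / δ) + U) +
            80 * ∑ i ∈ s, |cc₀ i| * ((((P i).A + (P i).B) * Sg i + R i * ((Q i).A + (Q i).B) + R i * Sg i)))
          cc (kappaBal N * transverseValue) + C * θ / (1 - θ)) S.β0 := by
  classical
  -- `0 ≤ U` from the admissible factor `Lc = Lc^1`
  have hAdmL : Adm Lc := by simpa using hAdm 1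
  have hU : 0 ≤ U := by
    obtain ⟨R₀, _, h⟩ := hident Lc hAdmL hL
    exact (abs_nonneg _).trans h
  -- outside the window nothing is in it
  have hnot : ∀ n r : ℕ, M n ≤ r → ∀ w ∈ annulus 4 r (r + 1), w ∉ annulus 4 0 (M n) := by
    intro n r hr w hw h'
    have h1 := (DyadicShell.mem_annulus_iff.mp hw).1
    have h2 := (DyadicShell.mem_annulus_iff.mp h').2
    omega
  -- the junk-extended families (agree with the data on `Adm`)
  let Fx : ι → ℕ → ℕ → Pt → ℝ := fun i n _ w =>
    if Adm n then F' i n w else if w ∈ annulus 4 0 (M n) then (P i).f n 0 w else 0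
  let Gx : ι → ℕ → ℕ → Pt → ℝ := fun i n _ w =>
    if Adm n then G' i n w else if w ∈ annulus 4 0 (M n) then (Q i).f n 0 w else 0
  let Bx : ℕ → ℝ := fun n =>
    if Adm n then B n else ∑ w ∈ annulus 4 0 (M n), toReal w μ * toReal w ν * ∑ i ∈ s, cc₀ i * (Fx i n 0 w * Gx i n 0 w)
  have hF' : ∀ n : ℕ, 2 ≤ n → ∀ k : ℕ, ∀ w ∈ annulus 4 0 (M n), ∀ i ∈ s,
      |Fx i n k w - (legAtZero (P i)).f n k w| ≤
        R i / ((supNorm w : ℝ) ^ ((legAtZero (P i)).a - 2) * (n : ℝ) ^ 2) := by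
    intro n hn k w hw i hi
    by_cases hA : Adm n
    · simp only [Fx, hA, if_true, legAtZero_f, legAtZero_a]
      exact hF n hA hn w hw i hi
    · simp only [Fx, hA, if_false, hw, if_true, legAtZero_f, legAtZero_a, sub_self, abs_zero]
      exact div_nonneg (hR i hi) (by positivity)
  have hG' : ∀ n : ℕ, 2 ≤ n → ∀ k : ℕ, ∀ w ∈ annulus 4 0 (M n), ∀ i ∈ s,
      |Gx i n k w - (legAtZero (Q i)).f n k w| ≤
        Sg i / ((supNorm w : ℝ) ^ ((legAtZero (Q i)).a - 2) * (n : ℝ) ^ 2) := by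
    intro n hn k w hw i hi
    by_cases hA : Adm n
    · simp only [Gx, hA, if_true, legAtZero_f, legAtZero_a]
      exact hG n hA hn w hw i hi
    · simp only [Gx, hA, if_false, hw, if_true, legAtZero_f, legAtZero_a, sub_self, abs_zero]
      exact div_nonneg (hS i hi) (by positivity)
  have hFtail' : ∀ n : ℕ, 2 ≤ n → ∀ k : ℕ, ∀ r : ℕ, M n ≤ r → ∀ w ∈ annulus 4 r (r + 1), ∀ i ∈ s,
      |Fx i n k w| ≤ R' i / ((r : ℝ) + 1) ^ (legAtZero (P i)).a * Real.exp (-(δ / n) * ((r : ℝ) + 1)) := by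
    intro n hn k r hr w hw i hi
    by_cases hA : Adm n
    · simp only [Fx, hA, if_true, legAtZero_a]
      exact hFtail n hA hn r hr w hw i hi
    · simp only [Fx, hA, if_false, hnot n r hr w hw, legAtZero_a, abs_zero]
      exact mul_nonneg (div_nonneg (hR' i hi) (by positivity)) (Real.exp_pos _).le
  have hGtail' : ∀ n : ℕ, 2 ≤ n → ∀ k : ℕ, ∀ r : ℕ, M n ≤ r → ∀ w ∈ annulus 4 r (r + 1), ∀ i ∈ s,
      |Gx i n k w| ≤ S' i / ((r : ℝ) + 1) ^ (legAtZero (Q i)).a := by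
    intro n hn k r hr w hw i hi
    by_cases hA : Adm n
    · simp only [Gx, hA, if_true, legAtZero_a]
      exact hGtail n hA hn r hr w hw i hi
    · simp only [Gx, hA, if_false, hnot n r hr w hw, legAtZero_a, abs_zero]
      exact div_nonneg (hS' i hi) (by positivity)
  have hident' : ∀ n : ℕ, 2 ≤ n → ∀ k : ℕ, ∃ R₀ : ℕ, M n ≤ R₀ ∧
      |Bx n - ∑ w ∈ annulus 4 0 R₀, toReal w μ * toReal w ν * ∑ i ∈ s, cc₀ i * (Fx i n k w * Gx i n k w)| ≤ U := by
    intro n hn k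
    by_cases hA : Adm n
    · obtain ⟨R₀, hR₀, h⟩ := hident n hA hn
      refine ⟨R₀, hR₀, ?_⟩
      simp only [Bx, Fx, Gx, hA, if_true]
      exact h
    · refine ⟨M n, le_rfl, ?_⟩
      show |(if Adm n then B n else ∑ w ∈ annulus 4 0 (M n), toReal w μ * toReal w ν *
          ∑ i ∈ s, cc₀ i * (Fx i n 0 w * Gx i n 0 w)) -
          ∑ w ∈ annulus 4 0 (M n), toReal w μ * toReal w ν * ∑ i ∈ s, cc₀ i * (Fx i n 0 w * Gx i n 0 w)| ≤ U
      rw [if_neg hA, sub_self, abs_zero]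
      exact hU
  have hdeg' : ∀ i ∈ s, (legAtZero (P i)).a + (legAtZero (Q i)).a = 6 := hdeg
  have hval' : ∀ x : E4, x ≠ 0 →
      x μ * x ν * contBubble s cc₀ (fun i => legAtZero (P i)) (fun i => legAtZero (Q i)) x =
        leadingIntegrand (kappaBal N) μ ν x := hval
  have hcomp' : ∀ m : ℕ, composedCoeff μC m = Bx (Lc ^ m) := fun m => by
    simp only [Bx, hAdm m, if_true]; exact hcomp m
  have W := WindowInterface.windowDecomposition_of_legSplitInterface (β0 := fun n _ => Bx n)
    (P := fun i => legAtZero (P i)) (Q := fun i => legAtZero (Q i)) hdeg' hval' hR hS hR' hS' hδ hc hM hML hF' hG'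
    hFtail' hGtail' hident'
  exact oneLoopDrift_of_composedWindow S W hN hμν hML hL hC hθ0 hθ1 hsep hcomp'

/-- **THE COMPOSED ROAD, LEG LEVEL, RELATIVISED ⟹ ENDPOINT EXISTENCE.** [folklore] -/
theorem endpointExistence_of_composedLegInterfaceOn {β : HBeta} {Cn : B12.Construction} (hgen : ForwardGenerated Cn β)
    (S : B12Beta.OneLoopSplit β)
    (hdeg : ∀ i ∈ s, (P i).a + (Q i).a = 6) {μ ν : Fin 4} (hμν : μ ≠ ν) {N : ℝ} (hN : N ≠ 0)
    (hval : ∀ x : E4, x ≠ 0 → x μ * x ν * contBubble s cc₀ P Q x = leadingIntegrand (kappaBal N) μ ν x)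
    (Adm : ℕ → Prop) {Lc : ℕ} (hL : 2 ≤ Lc) (hAdm : ∀ m : ℕ, Adm (Lc ^ m))
    {B : ℕ → ℝ} {F' G' : ι → ℕ → Pt → ℝ} {R S' R' Sg : ι → ℝ} {δ U cc : ℝ} {M : ℕ → ℕ}
    (hR : ∀ i ∈ s, 0 ≤ R i) (hS : ∀ i ∈ s, 0 ≤ Sg i) (hR' : ∀ i ∈ s, 0 ≤ R' i) (hS' : ∀ i ∈ s, 0 ≤ S' i) (hδ : 0 < δ)
    (hc : 1 ≤ cc) (hM : ∀ L : ℕ, 2 ≤ L → 1 ≤ M L ∧ (L : ℝ) ≤ cc * M L) (hML : ∀ L : ℕ, 2 ≤ L → M L ≤ L)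
    (hF : ∀ n : ℕ, Adm n → 2 ≤ n → ∀ w ∈ annulus 4 0 (M n), ∀ i ∈ s,
      |F' i n w - (P i).f n 0 w| ≤ R i / ((supNorm w : ℝ) ^ ((P i).a - 2) * (n : ℝ) ^ 2))
    (hG : ∀ n : ℕ, Adm n → 2 ≤ n → ∀ w ∈ annulus 4 0 (M n), ∀ i ∈ s,
      |G' i n w - (Q i).f n 0 w| ≤ Sg i / ((supNorm w : ℝ) ^ ((Q i).a - 2) * (n : ℝ) ^ 2))
    (hFtail : ∀ n : ℕ, Adm n → 2 ≤ n → ∀ r : ℕ, M n ≤ r → ∀ w ∈ annulus 4 r (r + 1), ∀ i ∈ s,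
      |F' i n w| ≤ R' i / ((r : ℝ) + 1) ^ (P i).a * Real.exp (-(δ / n) * ((r : ℝ) + 1)))
    (hGtail : ∀ n : ℕ, Adm n → 2 ≤ n → ∀ r : ℕ, M n ≤ r → ∀ w ∈ annulus 4 r (r + 1), ∀ i ∈ s,
      |G' i n w| ≤ S' i / ((r : ℝ) + 1) ^ (Q i).a)
    (hident : ∀ n : ℕ, Adm n → 2 ≤ n → ∃ R₀ : ℕ, M n ≤ R₀ ∧
      |B n - ∑ w ∈ annulus 4 0 R₀, toReal w μ * toReal w ν * ∑ i ∈ s, cc₀ i * (F' i n w * G' i n w)| ≤ U)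
    {μC : ℕ → ℕ → ℝ} {C θ : ℝ} (hC : 0 ≤ C) (hθ0 : 0 ≤ θ) (hθ1 : θ < 1)
    (hsep : SeparationRate C θ μC S.β0) (hcomp : ∀ m : ℕ, composedCoeff μC m = B (Lc ^ m))
    {Cr γ₀ β' : ℝ} (hγ₀ : 0 < γ₀)
    (hAF1 : ∀ k (p : Fin (k + 1) → ℝ), p ∈ B12Beta.HistBox γ₀ k → |S.β1 k p| ≤ Cr * p (Fin.last k))
    (hCr : 0 ≤ Cr) (hγ : Cr * γ₀ ≤ B12Normalization.stepBal N Lc) (hβ' : 0 ≤ β') (hcont : BetaContH γ₀ β)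
    (hup : BetaUpperH β' γ₀ β) : EndpointExistence Cn :=
  endpointExistence_of_drift hgen S hγ₀
    (oneLoopDrift_of_composedLegInterfaceOn S hdeg hμν hN hval Adm hL hAdm hR hS hR' hS' hδ hc hM hML hF hG hFtail
      hGtail hident hC hθ0 hθ1 hsep hcomp)
    hAF1 hCr hγ hβ' hcont hup

end LegLevelOn

/-! ## 6. (v1.2) The END statements on the composed road with the remainder in the PRINTED CONSTANT FORM (row an4,
`Beta.DriftRemainder`): `RemainderConst S γ₀ r` (`|β¹_{k+1}| ≤ r` on `]0,γ₀]^{k+1}`, all k) with `r ≤ stepBal N L`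
replaces (AF-1) `|β¹| ≤ C_r p_k`, `C_r γ₀ ≤ stepBal N L`; with the printed chain `r = ε₁·K_rem` (`Chain.abs_beta1_le`).
Kernel-checked as a snippet by row BETA-an4 gen 5 (`HOME/b2b-balaban-beta-an4/ComposedRoad-S6-remainderConst.snippet.lean`,
sha256[:16] 9b73cfc5534100af) and pasted verbatim. -/

open Literature.MathematicalPhysics.QuantumFieldTheory.Balaban1983to89.Beta.RemainderChain (RemainderConst Chain ChainSigns
  remCoeff)
open Literature.MathematicalPhysics.QuantumFieldTheory.Balaban1983to89.Beta.DriftRemainder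
  (betaPartialSumsLowerH_of_drift_remainderConst endpointExistence_of_drift_remainderConst
    p355Unconditional_of_drift_remainderConst)

section ComposedRemainder

variable {β : HBeta} {B : ℕ → ℝ} {μC : ℕ → ℕ → ℝ} {Ch Cg A₁ c : ℝ} {M : ℕ → ℕ} {N : ℝ} {μ ν : Fin 4} {L : ℕ} {C θ : ℝ}

/-- **(A-ps) ON THE COMPOSED ROAD, CONSTANT-FORM REMAINDER**: §2 + `RemainderConst S γ₀ r` + `r ≤ stepBal N L` ⟹
`BetaPartialSumsLowerH (2(A + Cθ/(1−θ))) γ₀ β`. [folklore] -/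
theorem betaPartialSumsLowerH_of_composedWindow_remainderConst (S : B12Beta.OneLoopSplit β)
    (W : WindowDecomposition (fun n _ => B n) (fun w => leadingIntegrand (kappaBal N) μ ν (toReal w)) Ch Cg A₁ c M)
    (hN : N ≠ 0) (hμν : μ ≠ ν) (hML : ∀ L : ℕ, 2 ≤ L → M L ≤ L) (hL : 2 ≤ L) (hC : 0 ≤ C) (hθ0 : 0 ≤ θ) (hθ1 : θ < 1)
    (hsep : SeparationRate C θ μC S.β0) (hcomp : ∀ m : ℕ, composedCoeff μC m = B (L ^ m)) {r γ₀ : ℝ}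
    (hrem : RemainderConst S γ₀ r) (hr : r ≤ B12Normalization.stepBal N L) :
    BetaPartialSumsLowerH (2 * (constA Ch Cg A₁ c (kappaBal N * transverseValue) + C * θ / (1 - θ))) γ₀ β :=
  betaPartialSumsLowerH_of_drift_remainderConst S (oneLoopDrift_of_composedWindow S W hN hμν hML hL hC hθ0 hθ1 hsep hcomp)
    hrem hr

/-- **ENDPOINT EXISTENCE ON THE COMPOSED ROAD, CONSTANT-FORM REMAINDER.** [folklore] -/
theorem endpointExistence_of_composedWindow_remainderConst {Cc : B12.Construction} (hgen : ForwardGenerated Cc β)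
    (S : B12Beta.OneLoopSplit β)
    (W : WindowDecomposition (fun n _ => B n) (fun w => leadingIntegrand (kappaBal N) μ ν (toReal w)) Ch Cg A₁ c M)
    (hN : N ≠ 0) (hμν : μ ≠ ν) (hML : ∀ L : ℕ, 2 ≤ L → M L ≤ L) (hL : 2 ≤ L) (hC : 0 ≤ C) (hθ0 : 0 ≤ θ) (hθ1 : θ < 1)
    (hsep : SeparationRate C θ μC S.β0) (hcomp : ∀ m : ℕ, composedCoeff μC m = B (L ^ m)) {r γ₀ β' : ℝ}
    (hγ₀ : 0 < γ₀) (hrem : RemainderConst S γ₀ r) (hr : r ≤ B12Normalization.stepBal N L) (hβ' : 0 ≤ β')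
    (hcont : BetaContH γ₀ β) (hup : BetaUpperH β' γ₀ β) : EndpointExistence Cc :=
  endpointExistence_of_drift_remainderConst hgen S hγ₀ (oneLoopDrift_of_composedWindow S W hN hμν hML hL hC hθ0 hθ1 hsep hcomp)
    hrem hr hβ' hcont hup

/-- **THE p. 355 READING ON THE COMPOSED ROAD, CONSTANT-FORM REMAINDER** (keeps `hnodes`). [folklore] -/
theorem p355Unconditional_of_composedWindow_remainderConst (w : World) (hγw : 0 < w.γ) {γ₀ : ℝ} (hγ₀ : w.γ ≤ γ₀)
    (hβup : 0 ≤ w.βup) (hnodes : ∀ P, Nodes (leaves w P))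
    (hgen : ForwardGenerated w.C.toB12 β) (hhalt : HaltsOutside w.C.toB12 β) (hcur : CurriesHBeta w.C.toB12 β)
    (hcont : BetaContH γ₀ β) (hup : BetaUpperH w.βup γ₀ β) (S : B12Beta.OneLoopSplit β)
    (W : WindowDecomposition (fun n _ => B n) (fun w => leadingIntegrand (kappaBal N) μ ν (toReal w)) Ch Cg A₁ c M)
    (hN : N ≠ 0) (hμν : μ ≠ ν) (hML : ∀ L : ℕ, 2 ≤ L → M L ≤ L) (hL : 2 ≤ L) (hC : 0 ≤ C) (hθ0 : 0 ≤ θ) (hθ1 : θ < 1)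
    (hsep : SeparationRate C θ μC S.β0) (hcomp : ∀ m : ℕ, composedCoeff μC m = B (L ^ m)) {r : ℝ}
    (hrem : RemainderConst S γ₀ r) (hr : r ≤ B12Normalization.stepBal N L)
    (hMγ : 2 * (constA Ch Cg A₁ c (kappaBal N * transverseValue) + C * θ / (1 - θ)) * w.γ ^ 2 ≤ w.β₀ * (2 + w.β₀)) :
    B16.Sect2Unconditional w.C ∧
      ∃ Em Ep : ℝ, ∀ m : ℕ, ∃ gstar : ℝ, 0 < gstar ∧ ∀ g : ℝ, 0 < g → g ≤ gstar →
        ∀ K : ℕ, ∃ g0 : ℝ, (w.C ⟨K, m, g0⟩).flow.g K = g ∧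
          ∀ k, k ≤ K → ∀ V : (w.C ⟨K, m, g0⟩).Cfg k, B16.UVIneq (w.C ⟨K, m, g0⟩) k V Em Ep :=
  p355Unconditional_of_drift_remainderConst w hγw hγ₀ hβup hnodes hgen hhalt hcur hcont hup S
    (oneLoopDrift_of_composedWindow S W hN hμν hML hL hC hθ0 hθ1 hsep hcomp) hrem hr hMγ

end ComposedRemainder

section LegLevelOnRemainder

variable {ι : Type*} {s : Finset ι} {cc₀ : ι → ℝ} {P Q : ι → Leg}

/-- **THE COMPOSED ROAD, LEG LEVEL, RELATIVISED, CONSTANT-FORM REMAINDER ⟹ ENDPOINT EXISTENCE**: the hypotheses of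
`oneLoopDrift_of_composedLegInterfaceOn` + `RemainderConst S γ₀ r` + `r ≤ stepBal N Lc` + (C) + the printed-type upper
bound. [folklore] -/
theorem endpointExistence_of_composedLegInterfaceOn_remainderConst {β : HBeta} {Cn : B12.Construction}
    (hgen : ForwardGenerated Cn β) (S : B12Beta.OneLoopSplit β)
    (hdeg : ∀ i ∈ s, (P i).a + (Q i).a = 6) {μ ν : Fin 4} (hμν : μ ≠ ν) {N : ℝ} (hN : N ≠ 0)
    (hval : ∀ x : E4, x ≠ 0 → x μ * x ν * contBubble s cc₀ P Q x = leadingIntegrand (kappaBal N) μ ν x)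
    (Adm : ℕ → Prop) {Lc : ℕ} (hL : 2 ≤ Lc) (hAdm : ∀ m : ℕ, Adm (Lc ^ m))
    {B : ℕ → ℝ} {F' G' : ι → ℕ → Pt → ℝ} {R S' R' Sg : ι → ℝ} {δ U cc : ℝ} {M : ℕ → ℕ}
    (hR : ∀ i ∈ s, 0 ≤ R i) (hS : ∀ i ∈ s, 0 ≤ Sg i) (hR' : ∀ i ∈ s, 0 ≤ R' i) (hS' : ∀ i ∈ s, 0 ≤ S' i) (hδ : 0 < δ)
    (hc : 1 ≤ cc) (hM : ∀ L : ℕ, 2 ≤ L → 1 ≤ M L ∧ (L : ℝ) ≤ cc * M L) (hML : ∀ L : ℕ, 2 ≤ L → M L ≤ L)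
    (hF : ∀ n : ℕ, Adm n → 2 ≤ n → ∀ w ∈ annulus 4 0 (M n), ∀ i ∈ s,
      |F' i n w - (P i).f n 0 w| ≤ R i / ((supNorm w : ℝ) ^ ((P i).a - 2) * (n : ℝ) ^ 2))
    (hG : ∀ n : ℕ, Adm n → 2 ≤ n → ∀ w ∈ annulus 4 0 (M n), ∀ i ∈ s,
      |G' i n w - (Q i).f n 0 w| ≤ Sg i / ((supNorm w : ℝ) ^ ((Q i).a - 2) * (n : ℝ) ^ 2))
    (hFtail : ∀ n : ℕ, Adm n → 2 ≤ n → ∀ r : ℕ, M n ≤ r → ∀ w ∈ annulus 4 r (r + 1), ∀ i ∈ s,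
      |F' i n w| ≤ R' i / ((r : ℝ) + 1) ^ (P i).a * Real.exp (-(δ / n) * ((r : ℝ) + 1)))
    (hGtail : ∀ n : ℕ, Adm n → 2 ≤ n → ∀ r : ℕ, M n ≤ r → ∀ w ∈ annulus 4 r (r + 1), ∀ i ∈ s,
      |G' i n w| ≤ S' i / ((r : ℝ) + 1) ^ (Q i).a)
    (hident : ∀ n : ℕ, Adm n → 2 ≤ n → ∃ R₀ : ℕ, M n ≤ R₀ ∧
      |B n - ∑ w ∈ annulus 4 0 R₀, toReal w μ * toReal w ν * ∑ i ∈ s, cc₀ i * (F' i n w * G' i n w)| ≤ U)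
    {μC : ℕ → ℕ → ℝ} {C θ : ℝ} (hC : 0 ≤ C) (hθ0 : 0 ≤ θ) (hθ1 : θ < 1)
    (hsep : SeparationRate C θ μC S.β0) (hcomp : ∀ m : ℕ, composedCoeff μC m = B (Lc ^ m))
    {rr γ₀ β' : ℝ} (hγ₀ : 0 < γ₀) (hrem : RemainderConst S γ₀ rr) (hr : rr ≤ B12Normalization.stepBal N Lc)
    (hβ' : 0 ≤ β') (hcont : BetaContH γ₀ β) (hup : BetaUpperH β' γ₀ β) : EndpointExistence Cn :=
  endpointExistence_of_drift_remainderConst hgen S hγ₀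
    (oneLoopDrift_of_composedLegInterfaceOn S hdeg hμν hN hval Adm hL hAdm hR hS hR' hS' hδ hc hM hML hF hG hFtail
      hGtail hident hC hθ0 hθ1 hsep hcomp)
    hrem hr hβ' hcont hup

/-- **… WITH THE PRINTED REMAINDER CHAIN** (`RemainderChain.Chain` + signs, ε₁-restriction `ε₁·K_rem ≤ stepBal N Lc`).
[folklore] -/
theorem endpointExistence_of_composedLegInterfaceOn_chain {β : HBeta} {Cn : B12.Construction}
    (hgen : ForwardGenerated Cn β) {S : B12Beta.OneLoopSplit β}
    {d : ℕ} {μr νr : Fin d} {cB : B13.Consts} {α₂ B₃ c₁ K₀ K₁ γ₀ : ℝ} (Rc : Chain d μr νr S γ₀ cB α₂ B₃ c₁ K₀ K₁)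
    (hs : ChainSigns cB α₂ B₃ K₀)
    (hdeg : ∀ i ∈ s, (P i).a + (Q i).a = 6) {μ ν : Fin 4} (hμν : μ ≠ ν) {N : ℝ} (hN : N ≠ 0)
    (hval : ∀ x : E4, x ≠ 0 → x μ * x ν * contBubble s cc₀ P Q x = leadingIntegrand (kappaBal N) μ ν x)
    (Adm : ℕ → Prop) {Lc : ℕ} (hL : 2 ≤ Lc) (hAdm : ∀ m : ℕ, Adm (Lc ^ m))
    {B : ℕ → ℝ} {F' G' : ι → ℕ → Pt → ℝ} {R S' R' Sg : ι → ℝ} {δ U cc : ℝ} {M : ℕ → ℕ}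
    (hR : ∀ i ∈ s, 0 ≤ R i) (hS : ∀ i ∈ s, 0 ≤ Sg i) (hR' : ∀ i ∈ s, 0 ≤ R' i) (hS' : ∀ i ∈ s, 0 ≤ S' i) (hδ : 0 < δ)
    (hc : 1 ≤ cc) (hM : ∀ L : ℕ, 2 ≤ L → 1 ≤ M L ∧ (L : ℝ) ≤ cc * M L) (hML : ∀ L : ℕ, 2 ≤ L → M L ≤ L)
    (hF : ∀ n : ℕ, Adm n → 2 ≤ n → ∀ w ∈ annulus 4 0 (M n), ∀ i ∈ s,
      |F' i n w - (P i).f n 0 w| ≤ R i / ((supNorm w : ℝ) ^ ((P i).a - 2) * (n : ℝ) ^ 2))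
    (hG : ∀ n : ℕ, Adm n → 2 ≤ n → ∀ w ∈ annulus 4 0 (M n), ∀ i ∈ s,
      |G' i n w - (Q i).f n 0 w| ≤ Sg i / ((supNorm w : ℝ) ^ ((Q i).a - 2) * (n : ℝ) ^ 2))
    (hFtail : ∀ n : ℕ, Adm n → 2 ≤ n → ∀ r : ℕ, M n ≤ r → ∀ w ∈ annulus 4 r (r + 1), ∀ i ∈ s,
      |F' i n w| ≤ R' i / ((r : ℝ) + 1) ^ (P i).a * Real.exp (-(δ / n) * ((r : ℝ) + 1)))
    (hGtail : ∀ n : ℕ, Adm n → 2 ≤ n → ∀ r : ℕ, M n ≤ r → ∀ w ∈ annulus 4 r (r + 1), ∀ i ∈ s,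
      |G' i n w| ≤ S' i / ((r : ℝ) + 1) ^ (Q i).a)
    (hident : ∀ n : ℕ, Adm n → 2 ≤ n → ∃ R₀ : ℕ, M n ≤ R₀ ∧
      |B n - ∑ w ∈ annulus 4 0 R₀, toReal w μ * toReal w ν * ∑ i ∈ s, cc₀ i * (F' i n w * G' i n w)| ≤ U)
    {μC : ℕ → ℕ → ℝ} {C θ : ℝ} (hC : 0 ≤ C) (hθ0 : 0 ≤ θ) (hθ1 : θ < 1)
    (hsep : SeparationRate C θ μC S.β0) (hcomp : ∀ m : ℕ, composedCoeff μC m = B (Lc ^ m))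
    {β' : ℝ} (hγ₀ : 0 < γ₀) (hε₁ : cB.ε₁ * remCoeff d cB α₂ B₃ c₁ K₀ K₁ ≤ B12Normalization.stepBal N Lc)
    (hβ' : 0 ≤ β') (hcont : BetaContH γ₀ β) (hup : BetaUpperH β' γ₀ β) : EndpointExistence Cn :=
  endpointExistence_of_composedLegInterfaceOn_remainderConst hgen S hdeg hμν hN hval Adm hL hAdm hR hS hR' hS' hδ hc hM hML
    hF hG hFtail hGtail hident hC hθ0 hθ1 hsep hcomp hγ₀ (Rc.abs_beta1_le hs) hε₁ hβ' hcont hup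

end LegLevelOnRemainder

/-! ## 7. (v1.2) The EXACT-IDENTITY instance of [H-germ′]: `IdentityForm μC β⁰` (defect zero) ⟹ no `Cθ/(1−θ)` term

The abstract identity shape is what `Beta/StrangFixMoment.identityForm_of_stepInvariant` (scalar Strang–Fix) and
`Beta/DecimatedMoment.wsum_second_of_vanishing` (two-sided, any ring) produce from step-invariance of the carried
(1.22)-moments; whether Bałaban's carried terms satisfy it EXACTLY or only in the `SeparationRate C θ` shape is row an2's
certificate, not this file's.  Here: the bookkeeping consequences, so that a certificate in EITHER shape plugs in. -/

section Identity

open Literature.MathematicalPhysics.QuantumFieldTheory.Balaban1983to89.Beta.MarginalTelescoping (IdentityForm)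
open Literature.MathematicalPhysics.QuantumFieldTheory.Balaban1983to89.Beta.OneShotTelescope (oneLoopDrift_of_telescope
  hTel_of_identityForm)

/-- Under the identity shape the print's-shape hypothesis holds with constant ZERO (any rate `θ`). [folklore] -/
theorem separationRate_zero_of_identityForm {μC : ℕ → ℕ → ℝ} {β0 : ℕ → ℝ} (h : IdentityForm μC β0) (θ : ℝ) :
    SeparationRate 0 θ μC β0 := by
  intro j k hjk
  rw [h j k hjk, sub_self, abs_zero, zero_mul]

/-- Under the identity shape and `composedCoeff μC m = B (L^m)` the flow partial sums TELESCOPE onto the first-step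
family: `Σ_{j<k} β0 j = B (L^k)` ((T1) of `Beta.OneShotTelescope`). [folklore] -/
theorem hTel_of_identityForm_comp {μC : ℕ → ℕ → ℝ} {β0 : ℕ → ℝ} {B : ℕ → ℝ} {L : ℕ} (h : IdentityForm μC β0)
    (hcomp : ∀ m : ℕ, composedCoeff μC m = B (L ^ m)) (k : ℕ) : ∑ j ∈ range k, β0 j = B (L ^ k) := by
  rw [hTel_of_identityForm h k, hcomp k]

variable {β : HBeta} {B : ℕ → ℝ} {μC : ℕ → ℕ → ℝ} {Ch Cg A₁ c : ℝ} {M : ℕ → ℕ} {N : ℝ} {μ ν : Fin 4} {L : ℕ}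

/-- **COMPOSED TWO-SIDED LAW + IDENTITY SHAPE ⟹ DRIFT WITH SLOPE `stepBal N L` AND DEFECT `A` ONLY.**  As
`oneLoopDrift_of_composedWindow` with `IdentityForm μC β⁰` in place of `SeparationRate C θ μC β⁰`: the conclusion is
`OneLoopDrift (stepBal N L) A β⁰`, `A = constA …` — no `Cθ/(1−θ)`. [folklore] -/
theorem oneLoopDrift_of_composedWindow_identity (S : B12Beta.OneLoopSplit β)
    (W : WindowDecomposition (fun n _ => B n) (fun w => leadingIntegrand (kappaBal N) μ ν (toReal w)) Ch Cg A₁ c M)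
    (hN : N ≠ 0) (hμν : μ ≠ ν) (hML : ∀ L : ℕ, 2 ≤ L → M L ≤ L) (hL : 2 ≤ L)
    (hid : IdentityForm μC S.β0) (hcomp : ∀ m : ℕ, composedCoeff μC m = B (L ^ m)) :
    OneLoopDrift (B12Normalization.stepBal N L) (constA Ch Cg A₁ c (kappaBal N * transverseValue)) S.β0 := by
  have hlg := logGrowth_stepBal W hN hμν hML
  have hBn : ∀ n : ℕ, 2 ≤ n →
      |B n - kappaBal N * transverseValue / Real.log 2 * Real.log n| ≤ constA Ch Cg A₁ c (kappaBal N * transverseValue) :=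
    fun n hn => hlg n hn 0
  have hA : 0 ≤ constA Ch Cg A₁ c (kappaBal N * transverseValue) := (abs_nonneg _).trans (hBn 2 le_rfl)
  have h := oneLoopDrift_of_telescope hL hA (hTel_of_identityForm_comp hid hcomp) hBn
  rwa [slope_kappaBal] at h

variable {ι : Type*} {s : Finset ι} {cc₀ : ι → ℝ} {P Q : ι → Leg}

/-- **THE COMPOSED ROAD, LEG LEVEL, RELATIVISED, IDENTITY SHAPE ⟹ DRIFT** — `oneLoopDrift_of_composedLegInterfaceOn` with
`IdentityForm μC β⁰` for [H-germ′]; the drift defect is the window constant alone. [folklore] -/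
theorem oneLoopDrift_of_composedLegInterfaceOn_identity (S : B12Beta.OneLoopSplit β)
    (hdeg : ∀ i ∈ s, (P i).a + (Q i).a = 6) (hμν : μ ≠ ν) (hN : N ≠ 0)
    (hval : ∀ x : E4, x ≠ 0 → x μ * x ν * contBubble s cc₀ P Q x = leadingIntegrand (kappaBal N) μ ν x)
    (Adm : ℕ → Prop) {Lc : ℕ} (hL : 2 ≤ Lc) (hAdm : ∀ m : ℕ, Adm (Lc ^ m))
    {F' G' : ι → ℕ → Pt → ℝ} {R S' R' Sg : ι → ℝ} {δ U cc : ℝ}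
    (hR : ∀ i ∈ s, 0 ≤ R i) (hS : ∀ i ∈ s, 0 ≤ Sg i) (hR' : ∀ i ∈ s, 0 ≤ R' i) (hS' : ∀ i ∈ s, 0 ≤ S' i) (hδ : 0 < δ)
    (hc : 1 ≤ cc) (hM : ∀ L : ℕ, 2 ≤ L → 1 ≤ M L ∧ (L : ℝ) ≤ cc * M L) (hML : ∀ L : ℕ, 2 ≤ L → M L ≤ L)
    (hF : ∀ n : ℕ, Adm n → 2 ≤ n → ∀ w ∈ annulus 4 0 (M n), ∀ i ∈ s,
      |F' i n w - (P i).f n 0 w| ≤ R i / ((supNorm w : ℝ) ^ ((P i).a - 2) * (n : ℝ) ^ 2))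
    (hG : ∀ n : ℕ, Adm n → 2 ≤ n → ∀ w ∈ annulus 4 0 (M n), ∀ i ∈ s,
      |G' i n w - (Q i).f n 0 w| ≤ Sg i / ((supNorm w : ℝ) ^ ((Q i).a - 2) * (n : ℝ) ^ 2))
    (hFtail : ∀ n : ℕ, Adm n → 2 ≤ n → ∀ r : ℕ, M n ≤ r → ∀ w ∈ annulus 4 r (r + 1), ∀ i ∈ s,
      |F' i n w| ≤ R' i / ((r : ℝ) + 1) ^ (P i).a * Real.exp (-(δ / n) * ((r : ℝ) + 1)))
    (hGtail : ∀ n : ℕ, Adm n → 2 ≤ n → ∀ r : ℕ, M n ≤ r → ∀ w ∈ annulus 4 r (r + 1), ∀ i ∈ s,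
      |G' i n w| ≤ S' i / ((r : ℝ) + 1) ^ (Q i).a)
    (hident : ∀ n : ℕ, Adm n → 2 ≤ n → ∃ R₀ : ℕ, M n ≤ R₀ ∧
      |B n - ∑ w ∈ annulus 4 0 R₀, toReal w μ * toReal w ν * ∑ i ∈ s, cc₀ i * (F' i n w * G' i n w)| ≤ U)
    (hid : IdentityForm μC S.β0) (hcomp : ∀ m : ℕ, composedCoeff μC m = B (Lc ^ m)) :
    OneLoopDrift (B12Normalization.stepBal N Lc)
      (constA (|kappaBal N| * 24 + |kappaBal N| * 110592) (bubbleConst s cc₀ P Q)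
          ((80 * (∑ i ∈ s, |cc₀ i| * (R' i * S' i)) * (1 + cc / δ) + U) +
            80 * ∑ i ∈ s, |cc₀ i| * ((((P i).A + (P i).B) * Sg i + R i * ((Q i).A + (Q i).B) + R i * Sg i)))
          cc (kappaBal N * transverseValue)) S.β0 := by
  have h := oneLoopDrift_of_composedLegInterfaceOn S hdeg hμν hN hval Adm hL hAdm hR hS hR' hS' hδ hc hM hML hF hG hFtail
    hGtail hident le_rfl le_rfl zero_lt_one (separationRate_zero_of_identityForm hid 0) hcomp
  rwa [show ((0 : ℝ) * 0 / (1 - 0)) = 0 by norm_num, add_zero] at h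

/-- **THE COMPOSED ROAD, LEG LEVEL, RELATIVISED, IDENTITY SHAPE, CONSTANT-FORM REMAINDER ⟹ ENDPOINT EXISTENCE** —
the (R10-1) wall with [H-germ′] in the exact shape and the remainder in print's type. [folklore] -/
theorem endpointExistence_of_composedLegInterfaceOn_identity_remainderConst {Cn : B12.Construction}
    (hgen : ForwardGenerated Cn β) (S : B12Beta.OneLoopSplit β)
    (hdeg : ∀ i ∈ s, (P i).a + (Q i).a = 6) (hμν : μ ≠ ν) (hN : N ≠ 0)
    (hval : ∀ x : E4, x ≠ 0 → x μ * x ν * contBubble s cc₀ P Q x = leadingIntegrand (kappaBal N) μ ν x)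
    (Adm : ℕ → Prop) {Lc : ℕ} (hL : 2 ≤ Lc) (hAdm : ∀ m : ℕ, Adm (Lc ^ m))
    {F' G' : ι → ℕ → Pt → ℝ} {R S' R' Sg : ι → ℝ} {δ U cc : ℝ}
    (hR : ∀ i ∈ s, 0 ≤ R i) (hS : ∀ i ∈ s, 0 ≤ Sg i) (hR' : ∀ i ∈ s, 0 ≤ R' i) (hS' : ∀ i ∈ s, 0 ≤ S' i) (hδ : 0 < δ)
    (hc : 1 ≤ cc) (hM : ∀ L : ℕ, 2 ≤ L → 1 ≤ M L ∧ (L : ℝ) ≤ cc * M L) (hML : ∀ L : ℕ, 2 ≤ L → M L ≤ L)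
    (hF : ∀ n : ℕ, Adm n → 2 ≤ n → ∀ w ∈ annulus 4 0 (M n), ∀ i ∈ s,
      |F' i n w - (P i).f n 0 w| ≤ R i / ((supNorm w : ℝ) ^ ((P i).a - 2) * (n : ℝ) ^ 2))
    (hG : ∀ n : ℕ, Adm n → 2 ≤ n → ∀ w ∈ annulus 4 0 (M n), ∀ i ∈ s,
      |G' i n w - (Q i).f n 0 w| ≤ Sg i / ((supNorm w : ℝ) ^ ((Q i).a - 2) * (n : ℝ) ^ 2))
    (hFtail : ∀ n : ℕ, Adm n → 2 ≤ n → ∀ r : ℕ, M n ≤ r → ∀ w ∈ annulus 4 r (r + 1), ∀ i ∈ s,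
      |F' i n w| ≤ R' i / ((r : ℝ) + 1) ^ (P i).a * Real.exp (-(δ / n) * ((r : ℝ) + 1)))
    (hGtail : ∀ n : ℕ, Adm n → 2 ≤ n → ∀ r : ℕ, M n ≤ r → ∀ w ∈ annulus 4 r (r + 1), ∀ i ∈ s,
      |G' i n w| ≤ S' i / ((r : ℝ) + 1) ^ (Q i).a)
    (hident : ∀ n : ℕ, Adm n → 2 ≤ n → ∃ R₀ : ℕ, M n ≤ R₀ ∧
      |B n - ∑ w ∈ annulus 4 0 R₀, toReal w μ * toReal w ν * ∑ i ∈ s, cc₀ i * (F' i n w * G' i n w)| ≤ U)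
    (hid : IdentityForm μC S.β0) (hcomp : ∀ m : ℕ, composedCoeff μC m = B (Lc ^ m))
    {rr γ₀ β' : ℝ} (hγ₀ : 0 < γ₀) (hrem : RemainderConst S γ₀ rr) (hr : rr ≤ B12Normalization.stepBal N Lc)
    (hβ' : 0 ≤ β') (hcont : BetaContH γ₀ β) (hup : BetaUpperH β' γ₀ β) : EndpointExistence Cn :=
  endpointExistence_of_drift_remainderConst hgen S hγ₀
    (oneLoopDrift_of_composedLegInterfaceOn_identity S hdeg hμν hN hval Adm hL hAdm hR hS hR' hS' hδ hc hM hML hF hG hFtail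
      hGtail hident hid hcomp)
    hrem hr hβ' hcont hup

end Identity

/-! ## 8. (v1.3) THE WALL WITHOUT `B` AND WITHOUT `hcomp`: window hypotheses for `composedCoeff μC m` along `n = Lc^m`

RULING (R11) (O2): on the composed road `B` is only ever read at `n = Lc^m`, where (typing (D-a)) it IS `composedCoeff μC m`.  Below the
window data (W2′)₀/(W3a)₀/(W3b)₀ are assumed for each `m` at the blocking factor `n = Lc^m` (families `F′ G′ : ι → ℕ → Pt → ℝ` indexed by
the blocking factor), `hident` compares the window sum with `composedCoeff μC m` itself, and [H-germ′] enters as `SeparationRate` (§8.2) or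
`IdentityForm` (§8.3).  Proof: instantiate §5/§7 with `Adm n :↔ ∃ m, n = Lc^m` and the first-step family
`B n := composedCoeff μC (the m with n = Lc^m)` (well defined by injectivity of `m ↦ Lc^m`, `Lc ≥ 2`). -/

section Pow

open Literature.MathematicalPhysics.QuantumFieldTheory.Balaban1983to89.Beta.MarginalTelescoping (IdentityForm)

variable {ι : Type*} {s : Finset ι} {cc₀ : ι → ℝ} {P Q : ι → Leg}

open Classical in
/-- The first-step family READ OFF the composed coefficients along the powers of `Lc`: at `n = Lc^m` it is `composedCoeff μC m`, elsewhere
`0` (junk, never read). [folklore] -/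
noncomputable def powFamily (μC : ℕ → ℕ → ℝ) (Lc : ℕ) (n : ℕ) : ℝ :=
  if h : ∃ m : ℕ, n = Lc ^ m then composedCoeff μC (Classical.choose h) else 0

/-- Along the powers the read-off family IS the composed coefficient (`Lc ≥ 2`: `m ↦ Lc^m` is injective). [folklore] -/
theorem powFamily_pow {μC : ℕ → ℕ → ℝ} {Lc : ℕ} (hL : 2 ≤ Lc) (m : ℕ) : powFamily μC Lc (Lc ^ m) = composedCoeff μC m := by
  classical
  have h : ∃ m' : ℕ, Lc ^ m = Lc ^ m' := ⟨m, rfl⟩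
  have hm : Classical.choose h = m := (Nat.pow_right_injective hL (Classical.choose_spec h)).symm
  simp only [powFamily, dif_pos h, hm]

/-- **THE COMPOSED ROAD, LEG LEVEL, ALONG THE POWERS, PRINT'S SHAPE ⟹ DRIFT.**  As `oneLoopDrift_of_composedLegInterfaceOn` with the
window data assumed for each `m ≥ 1` at `n = Lc^m` and the identification `hident` stated for `composedCoeff μC m` itself; no first-step family,
no `hcomp`. [folklore] -/
theorem oneLoopDrift_of_composedLegInterfacePow {β : HBeta} (S : B12Beta.OneLoopSplit β)
    (hdeg : ∀ i ∈ s, (P i).a + (Q i).a = 6) {μ ν : Fin 4} (hμν : μ ≠ ν) {N : ℝ} (hN : N ≠ 0)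
    (hval : ∀ x : E4, x ≠ 0 → x μ * x ν * contBubble s cc₀ P Q x = leadingIntegrand (kappaBal N) μ ν x)
    {Lc : ℕ} (hL : 2 ≤ Lc) {μC : ℕ → ℕ → ℝ}
    {F' G' : ι → ℕ → Pt → ℝ} {R S' R' Sg : ι → ℝ} {δ U cc : ℝ} {M : ℕ → ℕ}
    (hR : ∀ i ∈ s, 0 ≤ R i) (hS : ∀ i ∈ s, 0 ≤ Sg i) (hR' : ∀ i ∈ s, 0 ≤ R' i) (hS' : ∀ i ∈ s, 0 ≤ S' i) (hδ : 0 < δ)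
    (hc : 1 ≤ cc) (hM : ∀ L : ℕ, 2 ≤ L → 1 ≤ M L ∧ (L : ℝ) ≤ cc * M L) (hML : ∀ L : ℕ, 2 ≤ L → M L ≤ L)
    (hF : ∀ m : ℕ, 1 ≤ m → ∀ w ∈ annulus 4 0 (M (Lc ^ m)), ∀ i ∈ s,
      |F' i (Lc ^ m) w - (P i).f (Lc ^ m) 0 w| ≤ R i / ((supNorm w : ℝ) ^ ((P i).a - 2) * ((Lc ^ m : ℕ) : ℝ) ^ 2))
    (hG : ∀ m : ℕ, 1 ≤ m → ∀ w ∈ annulus 4 0 (M (Lc ^ m)), ∀ i ∈ s,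
      |G' i (Lc ^ m) w - (Q i).f (Lc ^ m) 0 w| ≤ Sg i / ((supNorm w : ℝ) ^ ((Q i).a - 2) * ((Lc ^ m : ℕ) : ℝ) ^ 2))
    (hFtail : ∀ m : ℕ, 1 ≤ m → ∀ r : ℕ, M (Lc ^ m) ≤ r → ∀ w ∈ annulus 4 r (r + 1), ∀ i ∈ s,
      |F' i (Lc ^ m) w| ≤ R' i / ((r : ℝ) + 1) ^ (P i).a * Real.exp (-(δ / ((Lc ^ m : ℕ) : ℝ)) * ((r : ℝ) + 1)))
    (hGtail : ∀ m : ℕ, 1 ≤ m → ∀ r : ℕ, M (Lc ^ m) ≤ r → ∀ w ∈ annulus 4 r (r + 1), ∀ i ∈ s,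
      |G' i (Lc ^ m) w| ≤ S' i / ((r : ℝ) + 1) ^ (Q i).a)
    (hident : ∀ m : ℕ, 1 ≤ m → ∃ R₀ : ℕ, M (Lc ^ m) ≤ R₀ ∧
      |composedCoeff μC m - ∑ w ∈ annulus 4 0 R₀, toReal w μ * toReal w ν *
        ∑ i ∈ s, cc₀ i * (F' i (Lc ^ m) w * G' i (Lc ^ m) w)| ≤ U)
    {C θ : ℝ} (hC : 0 ≤ C) (hθ0 : 0 ≤ θ) (hθ1 : θ < 1) (hsep : SeparationRate C θ μC S.β0) :
    OneLoopDrift (B12Normalization.stepBal N Lc)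
      (constA (|kappaBal N| * 24 + |kappaBal N| * 110592) (bubbleConst s cc₀ P Q)
          ((80 * (∑ i ∈ s, |cc₀ i| * (R' i * S' i)) * (1 + cc / δ) + U) +
            80 * ∑ i ∈ s, |cc₀ i| * ((((P i).A + (P i).B) * Sg i + R i * ((Q i).A + (Q i).B) + R i * Sg i)))
          cc (kappaBal N * transverseValue) + C * θ / (1 - θ)) S.β0 := by
  classical
  -- admissible blocking factors: the powers `Lc^m`; there the exponent is recovered by injectivity
  have hrec : ∀ n : ℕ, (∃ m : ℕ, n = Lc ^ m) → 2 ≤ n → ∃ m : ℕ, 1 ≤ m ∧ n = Lc ^ m := by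
    rintro n ⟨m, rfl⟩ hn
    refine ⟨m, ?_, rfl⟩
    rcases Nat.eq_zero_or_pos m with h0 | h0
    · subst h0; simp at hn
    · exact h0
  have hcomp : ∀ m : ℕ, composedCoeff μC m = powFamily μC Lc (Lc ^ m) := fun m => (powFamily_pow hL m).symm
  refine oneLoopDrift_of_composedLegInterfaceOn S hdeg hμν hN hval (fun n => ∃ m : ℕ, n = Lc ^ m) hL (fun m => ⟨m, rfl⟩)
    (B := powFamily μC Lc) (F' := F') (G' := G') hR hS hR' hS' hδ hc hM hML ?_ ?_ ?_ ?_ ?_ hC hθ0 hθ1 hsep hcomp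
  · intro n hA hn w hw i hi
    obtain ⟨m, hm, rfl⟩ := hrec n hA hn
    exact hF m hm w hw i hi
  · intro n hA hn w hw i hi
    obtain ⟨m, hm, rfl⟩ := hrec n hA hn
    exact hG m hm w hw i hi
  · intro n hA hn r hr w hw i hi
    obtain ⟨m, hm, rfl⟩ := hrec n hA hn
    exact hFtail m hm r hr w hw i hi
  · intro n hA hn r hr w hw i hi
    obtain ⟨m, hm, rfl⟩ := hrec n hA hn
    exact hGtail m hm r hr w hw i hi
  · intro n hA hn
    obtain ⟨m, hm, rfl⟩ := hrec n hA hn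
    obtain ⟨R₀, hR₀, h⟩ := hident m hm
    refine ⟨R₀, hR₀, ?_⟩
    rwa [powFamily_pow hL m]

/-- **THE COMPOSED ROAD, LEG LEVEL, ALONG THE POWERS, IDENTITY SHAPE ⟹ DRIFT** — the (R11) form of the wall: window data for
`composedCoeff μC m` at `n = Lc^m` + `IdentityForm μC β⁰`; drift defect = the window constant alone. [folklore] -/
theorem oneLoopDrift_of_composedLegInterfacePow_identity {β : HBeta} (S : B12Beta.OneLoopSplit β)
    (hdeg : ∀ i ∈ s, (P i).a + (Q i).a = 6) {μ ν : Fin 4} (hμν : μ ≠ ν) {N : ℝ} (hN : N ≠ 0)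
    (hval : ∀ x : E4, x ≠ 0 → x μ * x ν * contBubble s cc₀ P Q x = leadingIntegrand (kappaBal N) μ ν x)
    {Lc : ℕ} (hL : 2 ≤ Lc) {μC : ℕ → ℕ → ℝ}
    {F' G' : ι → ℕ → Pt → ℝ} {R S' R' Sg : ι → ℝ} {δ U cc : ℝ} {M : ℕ → ℕ}
    (hR : ∀ i ∈ s, 0 ≤ R i) (hS : ∀ i ∈ s, 0 ≤ Sg i) (hR' : ∀ i ∈ s, 0 ≤ R' i) (hS' : ∀ i ∈ s, 0 ≤ S' i) (hδ : 0 < δ)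
    (hc : 1 ≤ cc) (hM : ∀ L : ℕ, 2 ≤ L → 1 ≤ M L ∧ (L : ℝ) ≤ cc * M L) (hML : ∀ L : ℕ, 2 ≤ L → M L ≤ L)
    (hF : ∀ m : ℕ, 1 ≤ m → ∀ w ∈ annulus 4 0 (M (Lc ^ m)), ∀ i ∈ s,
      |F' i (Lc ^ m) w - (P i).f (Lc ^ m) 0 w| ≤ R i / ((supNorm w : ℝ) ^ ((P i).a - 2) * ((Lc ^ m : ℕ) : ℝ) ^ 2))
    (hG : ∀ m : ℕ, 1 ≤ m → ∀ w ∈ annulus 4 0 (M (Lc ^ m)), ∀ i ∈ s,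
      |G' i (Lc ^ m) w - (Q i).f (Lc ^ m) 0 w| ≤ Sg i / ((supNorm w : ℝ) ^ ((Q i).a - 2) * ((Lc ^ m : ℕ) : ℝ) ^ 2))
    (hFtail : ∀ m : ℕ, 1 ≤ m → ∀ r : ℕ, M (Lc ^ m) ≤ r → ∀ w ∈ annulus 4 r (r + 1), ∀ i ∈ s,
      |F' i (Lc ^ m) w| ≤ R' i / ((r : ℝ) + 1) ^ (P i).a * Real.exp (-(δ / ((Lc ^ m : ℕ) : ℝ)) * ((r : ℝ) + 1)))
    (hGtail : ∀ m : ℕ, 1 ≤ m → ∀ r : ℕ, M (Lc ^ m) ≤ r → ∀ w ∈ annulus 4 r (r + 1), ∀ i ∈ s,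
      |G' i (Lc ^ m) w| ≤ S' i / ((r : ℝ) + 1) ^ (Q i).a)
    (hident : ∀ m : ℕ, 1 ≤ m → ∃ R₀ : ℕ, M (Lc ^ m) ≤ R₀ ∧
      |composedCoeff μC m - ∑ w ∈ annulus 4 0 R₀, toReal w μ * toReal w ν *
        ∑ i ∈ s, cc₀ i * (F' i (Lc ^ m) w * G' i (Lc ^ m) w)| ≤ U)
    (hid : IdentityForm μC S.β0) :
    OneLoopDrift (B12Normalization.stepBal N Lc)
      (constA (|kappaBal N| * 24 + |kappaBal N| * 110592) (bubbleConst s cc₀ P Q)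
          ((80 * (∑ i ∈ s, |cc₀ i| * (R' i * S' i)) * (1 + cc / δ) + U) +
            80 * ∑ i ∈ s, |cc₀ i| * ((((P i).A + (P i).B) * Sg i + R i * ((Q i).A + (Q i).B) + R i * Sg i)))
          cc (kappaBal N * transverseValue)) S.β0 := by
  have h := oneLoopDrift_of_composedLegInterfacePow S hdeg hμν hN hval hL hR hS hR' hS' hδ hc hM hML hF hG hFtail hGtail hident
    le_rfl le_rfl zero_lt_one (separationRate_zero_of_identityForm hid 0)
  rwa [show ((0 : ℝ) * 0 / (1 - 0)) = 0 by norm_num, add_zero] at h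

/-- **… IDENTITY SHAPE, CONSTANT-FORM REMAINDER ⟹ ENDPOINT EXISTENCE** — the (R11)/(R10-1′) wall, end to end: leg table (W1)₀, window data
(W2′)₀/(W3a)₀ and identification (W3b)₀ for the COMPOSED coefficient along `n = Lc^m`, `IdentityForm` for [H-germ′], `RemainderConst` with
`r ≤ stepBal N Lc`, continuity (C) and the printed-type upper bound ⟹ `EndpointExistence`. [folklore] -/
theorem endpointExistence_of_composedLegInterfacePow_identity_remainderConst {β : HBeta} {Cn : B12.Construction}
    (hgen : ForwardGenerated Cn β) (S : B12Beta.OneLoopSplit β)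
    (hdeg : ∀ i ∈ s, (P i).a + (Q i).a = 6) {μ ν : Fin 4} (hμν : μ ≠ ν) {N : ℝ} (hN : N ≠ 0)
    (hval : ∀ x : E4, x ≠ 0 → x μ * x ν * contBubble s cc₀ P Q x = leadingIntegrand (kappaBal N) μ ν x)
    {Lc : ℕ} (hL : 2 ≤ Lc) {μC : ℕ → ℕ → ℝ}
    {F' G' : ι → ℕ → Pt → ℝ} {R S' R' Sg : ι → ℝ} {δ U cc : ℝ} {M : ℕ → ℕ}
    (hR : ∀ i ∈ s, 0 ≤ R i) (hS : ∀ i ∈ s, 0 ≤ Sg i) (hR' : ∀ i ∈ s, 0 ≤ R' i) (hS' : ∀ i ∈ s, 0 ≤ S' i) (hδ : 0 < δ)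
    (hc : 1 ≤ cc) (hM : ∀ L : ℕ, 2 ≤ L → 1 ≤ M L ∧ (L : ℝ) ≤ cc * M L) (hML : ∀ L : ℕ, 2 ≤ L → M L ≤ L)
    (hF : ∀ m : ℕ, 1 ≤ m → ∀ w ∈ annulus 4 0 (M (Lc ^ m)), ∀ i ∈ s,
      |F' i (Lc ^ m) w - (P i).f (Lc ^ m) 0 w| ≤ R i / ((supNorm w : ℝ) ^ ((P i).a - 2) * ((Lc ^ m : ℕ) : ℝ) ^ 2))
    (hG : ∀ m : ℕ, 1 ≤ m → ∀ w ∈ annulus 4 0 (M (Lc ^ m)), ∀ i ∈ s,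
      |G' i (Lc ^ m) w - (Q i).f (Lc ^ m) 0 w| ≤ Sg i / ((supNorm w : ℝ) ^ ((Q i).a - 2) * ((Lc ^ m : ℕ) : ℝ) ^ 2))
    (hFtail : ∀ m : ℕ, 1 ≤ m → ∀ r : ℕ, M (Lc ^ m) ≤ r → ∀ w ∈ annulus 4 r (r + 1), ∀ i ∈ s,
      |F' i (Lc ^ m) w| ≤ R' i / ((r : ℝ) + 1) ^ (P i).a * Real.exp (-(δ / ((Lc ^ m : ℕ) : ℝ)) * ((r : ℝ) + 1)))
    (hGtail : ∀ m : ℕ, 1 ≤ m → ∀ r : ℕ, M (Lc ^ m) ≤ r → ∀ w ∈ annulus 4 r (r + 1), ∀ i ∈ s,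
      |G' i (Lc ^ m) w| ≤ S' i / ((r : ℝ) + 1) ^ (Q i).a)
    (hident : ∀ m : ℕ, 1 ≤ m → ∃ R₀ : ℕ, M (Lc ^ m) ≤ R₀ ∧
      |composedCoeff μC m - ∑ w ∈ annulus 4 0 R₀, toReal w μ * toReal w ν *
        ∑ i ∈ s, cc₀ i * (F' i (Lc ^ m) w * G' i (Lc ^ m) w)| ≤ U)
    (hid : IdentityForm μC S.β0)
    {rr γ₀ β' : ℝ} (hγ₀ : 0 < γ₀) (hrem : RemainderConst S γ₀ rr) (hr : rr ≤ B12Normalization.stepBal N Lc)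
    (hβ' : 0 ≤ β') (hcont : BetaContH γ₀ β) (hup : BetaUpperH β' γ₀ β) : EndpointExistence Cn :=
  endpointExistence_of_drift_remainderConst hgen S hγ₀
    (oneLoopDrift_of_composedLegInterfacePow_identity S hdeg hμν hN hval hL hR hS hR' hS' hδ hc hM hML hF hG hFtail hGtail hident hid)
    hrem hr hβ' hcont hup

end Pow

/-! ## 9. (v1.4) Distance-form and scale-form ADAPTERS for the leg binders (model-free)

The rows deliver leg bounds in the shape `|K(x,x′)| ≤ R′/T(x,x′)^a · e^{−(δ/n)·T(x,x′)}` with `T` a lattice distance in fine units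
(`Beta/SliceLegs` §4: torus distance `T P 0 x x′`; `TransportLeg`: block-unit distance), and in-window corrections as `|R| ≤ D/n^a`
on the whole lattice (`WoodburyFibre`/`WoodburyCovariant`).  Read as functions of the difference `w ∈ Pt` with ANY `T w ≥ ‖w‖_∞`, these
are the binders `hFtail`/`hGtail`/`hF`/`hG` of §4/§5/§8 — the lemmas below do the (monotone) conversion once. -/

section Adapters

/-- **SHELL ADAPTER, EXPONENTIAL FORM.**  `|x| ≤ R′/T^a·e^{−cT}` with `T ≥ ‖w‖_∞`, `w` on the shell `‖w‖_∞ = r+1`, `R′, c ≥ 0` ⟹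
`|x| ≤ R′/(r+1)^a·e^{−c(r+1)}` (both factors are antitone in `T`). [folklore] -/
theorem shellBound_of_distExp {x R' c T : ℝ} {a r : ℕ} {w : Pt} (hR : 0 ≤ R') (hc : 0 ≤ c)
    (hw : w ∈ annulus 4 r (r + 1)) (hT : ((supNorm w : ℕ) : ℝ) ≤ T)
    (h : |x| ≤ R' / T ^ a * Real.exp (-c * T)) :
    |x| ≤ R' / ((r : ℝ) + 1) ^ a * Real.exp (-c * ((r : ℝ) + 1)) := by
  have hs : ((supNorm w : ℕ) : ℝ) = (r : ℝ) + 1 := by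
    rw [DyadicShell.supNorm_eq_of_mem_sphere hw]; push_cast; ring
  rw [hs] at hT
  have hr1 : (0 : ℝ) < (r : ℝ) + 1 := by positivity
  have hT0 : 0 < T := hr1.trans_le hT
  refine h.trans (mul_le_mul ?_ ?_ (Real.exp_pos _).le (by positivity))
  · exact div_le_div_of_nonneg_left hR (by positivity) (pow_le_pow_left₀ hr1.le hT a)
  · exact Real.exp_le_exp.mpr (by nlinarith)

/-- **SHELL ADAPTER, PURE POWER.**  `|x| ≤ S′/T^a` with `T ≥ ‖w‖_∞` on the shell `‖w‖_∞ = r+1`, `S′ ≥ 0` ⟹ `|x| ≤ S′/(r+1)^a`.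
[folklore] -/
theorem shellBound_of_distPow {x S' T : ℝ} {a r : ℕ} {w : Pt} (hS : 0 ≤ S') (hw : w ∈ annulus 4 r (r + 1))
    (hT : ((supNorm w : ℕ) : ℝ) ≤ T) (h : |x| ≤ S' / T ^ a) : |x| ≤ S' / ((r : ℝ) + 1) ^ a := by
  have hs : ((supNorm w : ℕ) : ℝ) = (r : ℝ) + 1 := by
    rw [DyadicShell.supNorm_eq_of_mem_sphere hw]; push_cast; ring
  rw [hs] at hT
  have hr1 : (0 : ℝ) < (r : ℝ) + 1 := by positivity
  exact h.trans (div_le_div_of_nonneg_left hS (by positivity) (pow_le_pow_left₀ hr1.le hT a))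

/-- **FAMILY FORM OF THE EXPONENTIAL SHELL ADAPTER** — exactly the `hFtail` binder of §8 (`…Pow`), for a family `F n w` bounded through a
distance family `T n w ≥ ‖w‖_∞` (`w ≠ 0`) as `R′/(T n w)^a · e^{−(δ/n)·T n w}`, `R′ ≥ 0`, `δ ≥ 0`. [folklore] -/
theorem tailExp_of_distFamily {F T : ℕ → Pt → ℝ} {R' δ : ℝ} {a : ℕ} (hR : 0 ≤ R') (hδ : 0 ≤ δ)
    (hT : ∀ n : ℕ, ∀ w : Pt, w ≠ 0 → ((supNorm w : ℕ) : ℝ) ≤ T n w)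
    (h : ∀ n : ℕ, ∀ w : Pt, w ≠ 0 → |F n w| ≤ R' / T n w ^ a * Real.exp (-(δ / n) * T n w)) :
    ∀ n : ℕ, ∀ r : ℕ, ∀ w ∈ annulus 4 r (r + 1),
      |F n w| ≤ R' / ((r : ℝ) + 1) ^ a * Real.exp (-(δ / n) * ((r : ℝ) + 1)) := by
  intro n r w hw
  have hw0 : w ≠ 0 := by
    intro h0
    have h1 := (DyadicShell.mem_annulus_iff.mp hw).1
    rw [h0, DyadicShell.supNorm_eq_zero_iff.mpr rfl] at h1
    omega
  exact shellBound_of_distExp hR (div_nonneg hδ (Nat.cast_nonneg n)) hw (hT n w hw0) (h n w hw0)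

/-- **FAMILY FORM OF THE PURE-POWER SHELL ADAPTER** — exactly the `hGtail` binder of §8. [folklore] -/
theorem tailPow_of_distFamily {G T : ℕ → Pt → ℝ} {S' : ℝ} {a : ℕ} (hS : 0 ≤ S')
    (hT : ∀ n : ℕ, ∀ w : Pt, w ≠ 0 → ((supNorm w : ℕ) : ℝ) ≤ T n w)
    (h : ∀ n : ℕ, ∀ w : Pt, w ≠ 0 → |G n w| ≤ S' / T n w ^ a) :
    ∀ n : ℕ, ∀ r : ℕ, ∀ w ∈ annulus 4 r (r + 1), |G n w| ≤ S' / ((r : ℝ) + 1) ^ a := by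
  intro n r w hw
  have hw0 : w ≠ 0 := by
    intro h0
    have h1 := (DyadicShell.mem_annulus_iff.mp hw).1
    rw [h0, DyadicShell.supNorm_eq_zero_iff.mpr rfl] at h1
    omega
  exact shellBound_of_distPow hS hw (hT n w hw0) (h n w hw0)

/-- **FAMILY FORM OF THE WINDOW ADAPTER** — exactly the `hF`/`hG` binder of §8: a whole-lattice scale bound `|F n w − f n w| ≤ D/n^a`
(`a ≥ 2`, `D ≥ 0`) and the window comparability `M n ≤ n` give `D/(‖w‖_∞^{a−2}·n²)` on the window `0 < ‖w‖_∞ ≤ M n`.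
(`WindowInterface.windowBound_of_scaleBound` pointwise.) [folklore] -/
theorem window_of_scaleFamily {F f : ℕ → Pt → ℝ} {D : ℝ} {a : ℕ} {M : ℕ → ℕ} (hD : 0 ≤ D) (ha : 2 ≤ a)
    (hML : ∀ n : ℕ, 2 ≤ n → M n ≤ n)
    (h : ∀ n : ℕ, 2 ≤ n → ∀ w : Pt, w ≠ 0 → |F n w - f n w| ≤ D / (n : ℝ) ^ a) :
    ∀ n : ℕ, 2 ≤ n → ∀ w ∈ annulus 4 0 (M n), |F n w - f n w| ≤ D / (((supNorm w : ℕ) : ℝ) ^ (a - 2) * (n : ℝ) ^ 2) := by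
  intro n hn w hw
  have hm := DyadicShell.mem_annulus_iff.mp hw
  have hw0 : w ≠ 0 := by
    intro h0
    rw [h0, DyadicShell.supNorm_eq_zero_iff.mpr rfl] at hm
    omega
  have hwn : ((supNorm w : ℕ) : ℝ) ≤ (n : ℝ) := by exact_mod_cast hm.2.trans (hML n hn)
  exact WindowInterface.windowBound_of_scaleBound hD ha hw0 hwn (h n hn w hw0)

end Adapters

/-! ## 10. (v1.5, RULING (R13-3)) BASE-POINT-AVERAGED identification: leg data PER BASE POINT `b`, and the identification
binder for a CONVEX COMBINATION (e.g. the block average) of the single-base-point bubble window sums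

The one-shot entries at blocking factor `n` are `n`-block-periodic jointly, not fine-translation invariant (an3-g6,
`Beta/SquareTable` v1.3 §10: «the reading of a block-structured kernel as a function of the displacement — the lead's»;
BETA-SPEC §7.24 RULING (R13-3)).  The wall's single-displacement leg families are therefore READ PER BASE POINT `b`
(`F′ b i n w` = the leg entry at `(b + w, b)`), the leg certificates (W2′)₀/(W3a)₀ are required for every `b` in a finite
set `Bset n` with `b`-free constants (as the rows state them), and the identification binder compares `composedCoeff μC m`
with a CONVEX COMBINATION (weights `wt n b ≥ 0`, `Σ_{b ∈ Bset n} wt n b = 1`; e.g. the uniform average over the base points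
of one `n`-block) of the single-base-point window sums.  The conclusion AND its constant are UNCHANGED: the in-window
comparison (`WindowInterface.inWindow_of_legPerturbation`) and the shellwise tail bound (`WindowInterface.shellBound_of_legDecay`)
are convex in the integrand.  The §8 binder `hident` is the one-point case `Bset n = {b₀}`, `wt n b₀ = 1`.  No analysis;
nothing of Bałaban's is asserted. -/

section Avg

variable {ι : Type*} {s : Finset ι} {cc₀ : ι → ℝ} {P Q : ι → Leg} {κB : Type*}

/-- A convex combination of reals each within `A` of `y` is within `A` of `y`. [folklore] -/
theorem abs_convexComb_sub_le {B : Finset κB} {wt x : κB → ℝ} {y A : ℝ} (h0 : ∀ b ∈ B, 0 ≤ wt b)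
    (h1 : ∑ b ∈ B, wt b = 1) (h : ∀ b ∈ B, |x b - y| ≤ A) : |∑ b ∈ B, wt b * x b - y| ≤ A := by
  have e : ∑ b ∈ B, wt b * x b - y = ∑ b ∈ B, wt b * (x b - y) := by
    simp only [mul_sub, Finset.sum_sub_distrib, ← Finset.sum_mul, h1, one_mul]
  rw [e]
  calc |∑ b ∈ B, wt b * (x b - y)| ≤ ∑ b ∈ B, |wt b * (x b - y)| := Finset.abs_sum_le_sum_abs _ _
    _ = ∑ b ∈ B, wt b * |x b - y| :=
        Finset.sum_congr rfl fun b hb => by rw [abs_mul, abs_of_nonneg (h0 b hb)]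
    _ ≤ ∑ b ∈ B, wt b * A := Finset.sum_le_sum fun b hb => mul_le_mul_of_nonneg_left (h b hb) (h0 b hb)
    _ = A := by rw [← Finset.sum_mul, h1, one_mul]

/-- A convex combination of reals each of size `≤ A` has size `≤ A`. [folklore] -/
theorem abs_convexComb_le {B : Finset κB} {wt x : κB → ℝ} {A : ℝ} (h0 : ∀ b ∈ B, 0 ≤ wt b)
    (h1 : ∑ b ∈ B, wt b = 1) (h : ∀ b ∈ B, |x b| ≤ A) : |∑ b ∈ B, wt b * x b| ≤ A := by
  have h' : ∀ b ∈ B, |x b - 0| ≤ A := fun b hb => by rw [sub_zero]; exact h b hb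
  simpa only [sub_zero] using abs_convexComb_sub_le h0 h1 h'

/-- **THE ALL-LEG-LEVEL COMPOSITE WITH BASE-POINT-AVERAGED IDENTIFICATION** ((L,k)-indexed form; cf.
`WindowInterface.windowDecomposition_of_legSplitInterface`, the one-point case): table legs `P_i, Q_i`; for every blocking
factor `L ≥ 2` a finite set of base points `Bset L` with convex weights `wt L`; actual legs `F′ b i, G′ b i` for EACH base
point with the (W2′) window bounds and the (W3a) shellwise tails, constants free of `b`; identification of `β⁰(L,k)` with
the `wt`-CONVEX COMBINATION of the single-base-point lattice sums up to `U` ⟹ the SAME window decomposition with the SAME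
constant `A₁ = (80E(1 + c/δ) + U) + 80D`. [folklore] -/
theorem windowDecomposition_of_avgLegSplitInterface (hdeg : ∀ i ∈ s, (P i).a + (Q i).a = 6) {μ ν : Fin 4} {κ : ℝ}
    (hval : ∀ x : E4, x ≠ 0 → x μ * x ν * contBubble s cc₀ P Q x = leadingIntegrand κ μ ν x)
    {β0 : ℕ → ℕ → ℝ} {F' G' : κB → ι → ℕ → ℕ → Pt → ℝ} {R Sg R' S' : ι → ℝ} {δ U cc : ℝ} {M : ℕ → ℕ}
    {Bset : ℕ → Finset κB} {wt : ℕ → κB → ℝ}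
    (hwt0 : ∀ L : ℕ, 2 ≤ L → ∀ b ∈ Bset L, 0 ≤ wt L b) (hwt1 : ∀ L : ℕ, 2 ≤ L → ∑ b ∈ Bset L, wt L b = 1)
    (hR : ∀ i ∈ s, 0 ≤ R i) (hS : ∀ i ∈ s, 0 ≤ Sg i) (hR' : ∀ i ∈ s, 0 ≤ R' i) (hS' : ∀ i ∈ s, 0 ≤ S' i) (hδ : 0 < δ)
    (hc : 1 ≤ cc) (hM : ∀ L : ℕ, 2 ≤ L → 1 ≤ M L ∧ (L : ℝ) ≤ cc * M L) (hML : ∀ L : ℕ, 2 ≤ L → M L ≤ L)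
    (hF : ∀ L : ℕ, 2 ≤ L → ∀ k : ℕ, ∀ b ∈ Bset L, ∀ w ∈ annulus 4 0 (M L), ∀ i ∈ s,
      |F' b i L k w - (P i).f L k w| ≤ R i / ((supNorm w : ℝ) ^ ((P i).a - 2) * (L : ℝ) ^ 2))
    (hG : ∀ L : ℕ, 2 ≤ L → ∀ k : ℕ, ∀ b ∈ Bset L, ∀ w ∈ annulus 4 0 (M L), ∀ i ∈ s,
      |G' b i L k w - (Q i).f L k w| ≤ Sg i / ((supNorm w : ℝ) ^ ((Q i).a - 2) * (L : ℝ) ^ 2))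
    (hFtail : ∀ L : ℕ, 2 ≤ L → ∀ k : ℕ, ∀ b ∈ Bset L, ∀ r : ℕ, M L ≤ r → ∀ w ∈ annulus 4 r (r + 1), ∀ i ∈ s,
      |F' b i L k w| ≤ R' i / ((r : ℝ) + 1) ^ (P i).a * Real.exp (-(δ / L) * ((r : ℝ) + 1)))
    (hGtail : ∀ L : ℕ, 2 ≤ L → ∀ k : ℕ, ∀ b ∈ Bset L, ∀ r : ℕ, M L ≤ r → ∀ w ∈ annulus 4 r (r + 1), ∀ i ∈ s,
      |G' b i L k w| ≤ S' i / ((r : ℝ) + 1) ^ (Q i).a)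
    (hident : ∀ L : ℕ, 2 ≤ L → ∀ k : ℕ, ∃ R₀ : ℕ, M L ≤ R₀ ∧
      |β0 L k - ∑ b ∈ Bset L, wt L b * ∑ w ∈ annulus 4 0 R₀, toReal w μ * toReal w ν *
        ∑ i ∈ s, cc₀ i * (F' b i L k w * G' b i L k w)| ≤ U) :
    WindowDecomposition β0 (fun w => leadingIntegrand κ μ ν (toReal w)) (|κ| * 24 + |κ| * 110592) (bubbleConst s cc₀ P Q)
      ((80 * (∑ i ∈ s, |cc₀ i| * (R' i * S' i)) * (1 + cc / δ) + U) +
        80 * ∑ i ∈ s, |cc₀ i| * ((((P i).A + (P i).B) * Sg i + R i * ((Q i).A + (Q i).B) + R i * Sg i))) cc M := by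
  classical
  -- the single-base-point integrands and their convex combination
  let Kb : κB → ℕ → ℕ → Pt → ℝ := fun b L k w =>
    toReal w μ * toReal w ν * ∑ i ∈ s, cc₀ i * (F' b i L k w * G' b i L k w)
  let Kavg : ℕ → ℕ → Pt → ℝ := fun L k w => ∑ b ∈ Bset L, wt L b * Kb b L k w
  have hDnn : 0 ≤ ∑ i ∈ s, |cc₀ i| * ((((P i).A + (P i).B) * Sg i + R i * ((Q i).A + (Q i).B) + R i * Sg i)) := by
    refine Finset.sum_nonneg fun i hi => mul_nonneg (abs_nonneg _) ?_
    have := (P i).nonneg_A; have := (P i).nonneg_B; have := (Q i).nonneg_A; have := (Q i).nonneg_B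
    have := hR i hi; have := hS i hi
    positivity
  have hE : 0 ≤ ∑ i ∈ s, |cc₀ i| * (R' i * S' i) :=
    Finset.sum_nonneg fun i hi => mul_nonneg (abs_nonneg _) (mul_nonneg (hR' i hi) (hS' i hi))
  -- (W2) for the averaged integrand: convexity of the in-window comparison
  have hin : ∀ L : ℕ, 2 ≤ L → ∀ k : ℕ, ∀ w ∈ annulus 4 0 (M L),
      |Kavg L k w - toReal w μ * toReal w ν * BubbleTransfer.lattBubble s cc₀ P Q L k w| ≤
        (∑ i ∈ s, |cc₀ i| * ((((P i).A + (P i).B) * Sg i + R i * ((Q i).A + (Q i).B) + R i * Sg i))) /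
          ((supNorm w : ℝ) ^ 2 * (L : ℝ) ^ 2) := by
    intro L hL k w hw
    have hw0 : w ≠ 0 := DyadicShell.ne_zero_of_mem_annulus hw
    have hwM : supNorm w ≤ M L := (DyadicShell.mem_annulus_iff.mp hw).2
    have hwL : (supNorm w : ℝ) ≤ L := by exact_mod_cast hwM.trans (hML L hL)
    exact abs_convexComb_sub_le (hwt0 L hL) (hwt1 L hL) fun b hb =>
      WindowInterface.inWindow_of_legPerturbation hdeg μ ν hw0 hwL hR hS (fun i hi => hF L hL k b hb w hw i hi)
        (fun i hi => hG L hL k b hb w hw i hi)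
  -- (W3a) for the averaged integrand: convexity of the shellwise tail bound
  have htail : ∀ L : ℕ, 2 ≤ L → ∀ k : ℕ, ∀ r : ℕ, M L ≤ r → ∀ w ∈ annulus 4 r (r + 1),
      |Kavg L k w| ≤ (∑ i ∈ s, |cc₀ i| * (R' i * S' i)) / ((r : ℝ) + 1) ^ 4 * Real.exp (-(δ / L) * ((r : ℝ) + 1)) := by
    intro L hL k r hr w hw
    exact abs_convexComb_le (hwt0 L hL) (hwt1 L hL) fun b hb =>
      WindowInterface.shellBound_of_legDecay hdeg μ ν hw (Real.exp_pos _).le hR'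
        (fun i hi => hFtail L hL k b hb r hr w hw i hi) (fun i hi => hGtail L hL k b hb r hr w hw i hi)
  -- (W3b): the convex combination of window sums is the window sum of the averaged integrand
  have hident' : ∀ L : ℕ, 2 ≤ L → ∀ k : ℕ, ∃ R₀ : ℕ, M L ≤ R₀ ∧
      |β0 L k - ∑ w ∈ annulus 4 0 R₀, Kavg L k w| ≤ U := by
    intro L hL k
    obtain ⟨R₀, hR₀, h⟩ := hident L hL k
    refine ⟨R₀, hR₀, ?_⟩
    have e : ∑ w ∈ annulus 4 0 R₀, Kavg L k w = ∑ b ∈ Bset L, wt L b * ∑ w ∈ annulus 4 0 R₀, Kb b L k w := by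
      simp only [Kavg, Finset.mul_sum]
      exact Finset.sum_comm
    rw [e]
    exact h
  exact WindowInterface.windowDecomposition_of_interface' hdeg hval hDnn hc hM hML hin
    (WindowInterface.hout_of_split (WindowInterface.tail_of_shellBound hE hδ hM htail) hident')

open Literature.MathematicalPhysics.QuantumFieldTheory.Balaban1983to89.Beta.MarginalTelescoping (IdentityForm)

/-- **THE WALL WITH THE BASE-POINT-AVERAGED IDENTIFICATION, IDENTITY SHAPE ⟹ DRIFT** (RULING (R13-3)): as
`oneLoopDrift_of_composedLegInterfacePow_identity` (§8), but the leg data are given PER BASE POINT `b ∈ Bset n` (constants free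
of `b`) and `hident` compares `composedCoeff μC m` with the `wt`-convex combination of the single-base-point window sums at
`n = Lc^m`.  SAME conclusion, SAME constant. [folklore] -/
theorem oneLoopDrift_of_composedLegInterfacePow_identity_avg {β : HBeta} (S : B12Beta.OneLoopSplit β)
    (hdeg : ∀ i ∈ s, (P i).a + (Q i).a = 6) {μ ν : Fin 4} (hμν : μ ≠ ν) {N : ℝ} (hN : N ≠ 0)
    (hval : ∀ x : E4, x ≠ 0 → x μ * x ν * contBubble s cc₀ P Q x = leadingIntegrand (kappaBal N) μ ν x)
    {Lc : ℕ} (hL : 2 ≤ Lc) {μC : ℕ → ℕ → ℝ}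
    {F' G' : κB → ι → ℕ → Pt → ℝ} {R Sg R' S' : ι → ℝ} {δ U cc : ℝ} {M : ℕ → ℕ}
    {Bset : ℕ → Finset κB} {wt : ℕ → κB → ℝ}
    (hwt0 : ∀ n : ℕ, 2 ≤ n → ∀ b ∈ Bset n, 0 ≤ wt n b) (hwt1 : ∀ n : ℕ, 2 ≤ n → ∑ b ∈ Bset n, wt n b = 1)
    (hR : ∀ i ∈ s, 0 ≤ R i) (hS : ∀ i ∈ s, 0 ≤ Sg i) (hR' : ∀ i ∈ s, 0 ≤ R' i) (hS' : ∀ i ∈ s, 0 ≤ S' i) (hδ : 0 < δ)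
    (hc : 1 ≤ cc) (hM : ∀ L : ℕ, 2 ≤ L → 1 ≤ M L ∧ (L : ℝ) ≤ cc * M L) (hML : ∀ L : ℕ, 2 ≤ L → M L ≤ L)
    (hF : ∀ m : ℕ, 1 ≤ m → ∀ b ∈ Bset (Lc ^ m), ∀ w ∈ annulus 4 0 (M (Lc ^ m)), ∀ i ∈ s,
      |F' b i (Lc ^ m) w - (P i).f (Lc ^ m) 0 w| ≤ R i / ((supNorm w : ℝ) ^ ((P i).a - 2) * ((Lc ^ m : ℕ) : ℝ) ^ 2))
    (hG : ∀ m : ℕ, 1 ≤ m → ∀ b ∈ Bset (Lc ^ m), ∀ w ∈ annulus 4 0 (M (Lc ^ m)), ∀ i ∈ s,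
      |G' b i (Lc ^ m) w - (Q i).f (Lc ^ m) 0 w| ≤ Sg i / ((supNorm w : ℝ) ^ ((Q i).a - 2) * ((Lc ^ m : ℕ) : ℝ) ^ 2))
    (hFtail : ∀ m : ℕ, 1 ≤ m → ∀ b ∈ Bset (Lc ^ m), ∀ r : ℕ, M (Lc ^ m) ≤ r → ∀ w ∈ annulus 4 r (r + 1), ∀ i ∈ s,
      |F' b i (Lc ^ m) w| ≤ R' i / ((r : ℝ) + 1) ^ (P i).a * Real.exp (-(δ / ((Lc ^ m : ℕ) : ℝ)) * ((r : ℝ) + 1)))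
    (hGtail : ∀ m : ℕ, 1 ≤ m → ∀ b ∈ Bset (Lc ^ m), ∀ r : ℕ, M (Lc ^ m) ≤ r → ∀ w ∈ annulus 4 r (r + 1), ∀ i ∈ s,
      |G' b i (Lc ^ m) w| ≤ S' i / ((r : ℝ) + 1) ^ (Q i).a)
    (hident : ∀ m : ℕ, 1 ≤ m → ∃ R₀ : ℕ, M (Lc ^ m) ≤ R₀ ∧
      |composedCoeff μC m - ∑ b ∈ Bset (Lc ^ m), wt (Lc ^ m) b * ∑ w ∈ annulus 4 0 R₀, toReal w μ * toReal w ν *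
        ∑ i ∈ s, cc₀ i * (F' b i (Lc ^ m) w * G' b i (Lc ^ m) w)| ≤ U)
    (hid : IdentityForm μC S.β0) :
    OneLoopDrift (B12Normalization.stepBal N Lc)
      (constA (|kappaBal N| * 24 + |kappaBal N| * 110592) (bubbleConst s cc₀ P Q)
          ((80 * (∑ i ∈ s, |cc₀ i| * (R' i * S' i)) * (1 + cc / δ) + U) +
            80 * ∑ i ∈ s, |cc₀ i| * ((((P i).A + (P i).B) * Sg i + R i * ((Q i).A + (Q i).B) + R i * Sg i)))
          cc (kappaBal N * transverseValue)) S.β0 := by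
  classical
  -- admissible blocking factors `n = Lc^m`, `m ≥ 1` recovered from `n ≥ 2`
  have hrec : ∀ n : ℕ, (∃ m : ℕ, n = Lc ^ m) → 2 ≤ n → ∃ m : ℕ, 1 ≤ m ∧ n = Lc ^ m := by
    rintro n ⟨m, rfl⟩ hn
    refine ⟨m, ?_, rfl⟩
    rcases Nat.eq_zero_or_pos m with h0 | h0
    · subst h0; simp at hn
    · exact h0
  have hLc1 : (Lc : ℕ) = Lc ^ 1 := (pow_one Lc).symm
  have hU : 0 ≤ U := by
    obtain ⟨R₀, _, h⟩ := hident 1 le_rfl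
    exact (abs_nonneg _).trans h
  -- outside the window nothing is in it
  have hnot : ∀ n r : ℕ, M n ≤ r → ∀ w ∈ annulus 4 r (r + 1), w ∉ annulus 4 0 (M n) := by
    intro n r hr w hw h'
    have h1 := (DyadicShell.mem_annulus_iff.mp hw).1
    have h2 := (DyadicShell.mem_annulus_iff.mp h').2
    omega
  -- the junk-extended families (agree with the data on the powers; off the powers: table legs in the window, zero beyond)
  let Fx : κB → ι → ℕ → ℕ → Pt → ℝ := fun b i n _ w =>
    if ∃ m : ℕ, n = Lc ^ m then F' b i n w else if w ∈ annulus 4 0 (M n) then (P i).f n 0 w else 0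
  let Gx : κB → ι → ℕ → ℕ → Pt → ℝ := fun b i n _ w =>
    if ∃ m : ℕ, n = Lc ^ m then G' b i n w else if w ∈ annulus 4 0 (M n) then (Q i).f n 0 w else 0
  let Bx : ℕ → ℝ := fun n =>
    if ∃ m : ℕ, n = Lc ^ m then powFamily μC Lc n else
      ∑ b ∈ Bset n, wt n b * ∑ w ∈ annulus 4 0 (M n), toReal w μ * toReal w ν *
        ∑ i ∈ s, cc₀ i * (Fx b i n 0 w * Gx b i n 0 w)
  have hF' : ∀ n : ℕ, 2 ≤ n → ∀ k : ℕ, ∀ b ∈ Bset n, ∀ w ∈ annulus 4 0 (M n), ∀ i ∈ s,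
      |Fx b i n k w - (legAtZero (P i)).f n k w| ≤
        R i / ((supNorm w : ℝ) ^ ((legAtZero (P i)).a - 2) * (n : ℝ) ^ 2) := by
    intro n hn k b hb w hw i hi
    by_cases hA : ∃ m : ℕ, n = Lc ^ m
    · obtain ⟨m, hm, rfl⟩ := hrec n hA hn
      simp only [Fx, hA, if_true, legAtZero_f, legAtZero_a]
      exact hF m hm b hb w hw i hi
    · simp only [Fx, hA, if_false, hw, if_true, legAtZero_f, legAtZero_a, sub_self, abs_zero]
      exact div_nonneg (hR i hi) (by positivity)
  have hG' : ∀ n : ℕ, 2 ≤ n → ∀ k : ℕ, ∀ b ∈ Bset n, ∀ w ∈ annulus 4 0 (M n), ∀ i ∈ s,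
      |Gx b i n k w - (legAtZero (Q i)).f n k w| ≤
        Sg i / ((supNorm w : ℝ) ^ ((legAtZero (Q i)).a - 2) * (n : ℝ) ^ 2) := by
    intro n hn k b hb w hw i hi
    by_cases hA : ∃ m : ℕ, n = Lc ^ m
    · obtain ⟨m, hm, rfl⟩ := hrec n hA hn
      simp only [Gx, hA, if_true, legAtZero_f, legAtZero_a]
      exact hG m hm b hb w hw i hi
    · simp only [Gx, hA, if_false, hw, if_true, legAtZero_f, legAtZero_a, sub_self, abs_zero]
      exact div_nonneg (hS i hi) (by positivity)
  have hFtail' : ∀ n : ℕ, 2 ≤ n → ∀ k : ℕ, ∀ b ∈ Bset n, ∀ r : ℕ, M n ≤ r → ∀ w ∈ annulus 4 r (r + 1), ∀ i ∈ s,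
      |Fx b i n k w| ≤ R' i / ((r : ℝ) + 1) ^ (legAtZero (P i)).a * Real.exp (-(δ / n) * ((r : ℝ) + 1)) := by
    intro n hn k b hb r hr w hw i hi
    by_cases hA : ∃ m : ℕ, n = Lc ^ m
    · obtain ⟨m, hm, rfl⟩ := hrec n hA hn
      simp only [Fx, hA, if_true, legAtZero_a]
      exact hFtail m hm b hb r hr w hw i hi
    · simp only [Fx, hA, if_false, hnot n r hr w hw, legAtZero_a, abs_zero]
      exact mul_nonneg (div_nonneg (hR' i hi) (by positivity)) (Real.exp_pos _).le
  have hGtail' : ∀ n : ℕ, 2 ≤ n → ∀ k : ℕ, ∀ b ∈ Bset n, ∀ r : ℕ, M n ≤ r → ∀ w ∈ annulus 4 r (r + 1), ∀ i ∈ s,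
      |Gx b i n k w| ≤ S' i / ((r : ℝ) + 1) ^ (legAtZero (Q i)).a := by
    intro n hn k b hb r hr w hw i hi
    by_cases hA : ∃ m : ℕ, n = Lc ^ m
    · obtain ⟨m, hm, rfl⟩ := hrec n hA hn
      simp only [Gx, hA, if_true, legAtZero_a]
      exact hGtail m hm b hb r hr w hw i hi
    · simp only [Gx, hA, if_false, hnot n r hr w hw, legAtZero_a, abs_zero]
      exact div_nonneg (hS' i hi) (by positivity)
  have hident' : ∀ n : ℕ, 2 ≤ n → ∀ k : ℕ, ∃ R₀ : ℕ, M n ≤ R₀ ∧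
      |Bx n - ∑ b ∈ Bset n, wt n b * ∑ w ∈ annulus 4 0 R₀, toReal w μ * toReal w ν *
        ∑ i ∈ s, cc₀ i * (Fx b i n k w * Gx b i n k w)| ≤ U := by
    intro n hn k
    by_cases hA : ∃ m : ℕ, n = Lc ^ m
    · obtain ⟨m, hm, rfl⟩ := hrec n hA hn
      obtain ⟨R₀, hR₀, h⟩ := hident m hm
      refine ⟨R₀, hR₀, ?_⟩
      simp only [Bx, Fx, Gx, hA, if_true, powFamily_pow hL m]
      exact h
    · refine ⟨M n, le_rfl, ?_⟩
      show |(if ∃ m : ℕ, n = Lc ^ m then powFamily μC Lc n else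
          ∑ b ∈ Bset n, wt n b * ∑ w ∈ annulus 4 0 (M n), toReal w μ * toReal w ν *
            ∑ i ∈ s, cc₀ i * (Fx b i n 0 w * Gx b i n 0 w)) -
          ∑ b ∈ Bset n, wt n b * ∑ w ∈ annulus 4 0 (M n), toReal w μ * toReal w ν *
            ∑ i ∈ s, cc₀ i * (Fx b i n k w * Gx b i n k w)| ≤ U
      rw [if_neg hA, sub_self, abs_zero]
      exact hU
  have hdeg' : ∀ i ∈ s, (legAtZero (P i)).a + (legAtZero (Q i)).a = 6 := hdeg
  have hval' : ∀ x : E4, x ≠ 0 →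
      x μ * x ν * contBubble s cc₀ (fun i => legAtZero (P i)) (fun i => legAtZero (Q i)) x =
        leadingIntegrand (kappaBal N) μ ν x := hval
  have hcomp' : ∀ m : ℕ, composedCoeff μC m = Bx (Lc ^ m) := fun m => by
    have hA : ∃ m' : ℕ, Lc ^ m = Lc ^ m' := ⟨m, rfl⟩
    simp only [Bx, hA, if_true, powFamily_pow hL m]
  have W := windowDecomposition_of_avgLegSplitInterface (β0 := fun n _ => Bx n)
    (P := fun i => legAtZero (P i)) (Q := fun i => legAtZero (Q i)) hdeg' hval' hwt0 hwt1 hR hS hR' hS' hδ hc hM hML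
    hF' hG' hFtail' hGtail' hident'
  have h := oneLoopDrift_of_composedWindow S W hN hμν hML hL le_rfl le_rfl zero_lt_one
    (separationRate_zero_of_identityForm hid 0) hcomp'
  rwa [show ((0 : ℝ) * 0 / (1 - 0)) = 0 by norm_num, add_zero] at h

/-- **… BASE-POINT-AVERAGED IDENTIFICATION, IDENTITY SHAPE, CONSTANT-FORM REMAINDER ⟹ ENDPOINT EXISTENCE** (RULING (R13-3)):
the END statement from the averaged wall. [folklore] -/
theorem endpointExistence_of_composedLegInterfacePow_identity_avg_remainderConst {β : HBeta} {Cn : B12.Construction}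
    (hgen : ForwardGenerated Cn β) (S : B12Beta.OneLoopSplit β)
    (hdeg : ∀ i ∈ s, (P i).a + (Q i).a = 6) {μ ν : Fin 4} (hμν : μ ≠ ν) {N : ℝ} (hN : N ≠ 0)
    (hval : ∀ x : E4, x ≠ 0 → x μ * x ν * contBubble s cc₀ P Q x = leadingIntegrand (kappaBal N) μ ν x)
    {Lc : ℕ} (hL : 2 ≤ Lc) {μC : ℕ → ℕ → ℝ}
    {F' G' : κB → ι → ℕ → Pt → ℝ} {R Sg R' S' : ι → ℝ} {δ U cc : ℝ} {M : ℕ → ℕ}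
    {Bset : ℕ → Finset κB} {wt : ℕ → κB → ℝ}
    (hwt0 : ∀ n : ℕ, 2 ≤ n → ∀ b ∈ Bset n, 0 ≤ wt n b) (hwt1 : ∀ n : ℕ, 2 ≤ n → ∑ b ∈ Bset n, wt n b = 1)
    (hR : ∀ i ∈ s, 0 ≤ R i) (hS : ∀ i ∈ s, 0 ≤ Sg i) (hR' : ∀ i ∈ s, 0 ≤ R' i) (hS' : ∀ i ∈ s, 0 ≤ S' i) (hδ : 0 < δ)
    (hc : 1 ≤ cc) (hM : ∀ L : ℕ, 2 ≤ L → 1 ≤ M L ∧ (L : ℝ) ≤ cc * M L) (hML : ∀ L : ℕ, 2 ≤ L → M L ≤ L)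
    (hF : ∀ m : ℕ, 1 ≤ m → ∀ b ∈ Bset (Lc ^ m), ∀ w ∈ annulus 4 0 (M (Lc ^ m)), ∀ i ∈ s,
      |F' b i (Lc ^ m) w - (P i).f (Lc ^ m) 0 w| ≤ R i / ((supNorm w : ℝ) ^ ((P i).a - 2) * ((Lc ^ m : ℕ) : ℝ) ^ 2))
    (hG : ∀ m : ℕ, 1 ≤ m → ∀ b ∈ Bset (Lc ^ m), ∀ w ∈ annulus 4 0 (M (Lc ^ m)), ∀ i ∈ s,
      |G' b i (Lc ^ m) w - (Q i).f (Lc ^ m) 0 w| ≤ Sg i / ((supNorm w : ℝ) ^ ((Q i).a - 2) * ((Lc ^ m : ℕ) : ℝ) ^ 2))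
    (hFtail : ∀ m : ℕ, 1 ≤ m → ∀ b ∈ Bset (Lc ^ m), ∀ r : ℕ, M (Lc ^ m) ≤ r → ∀ w ∈ annulus 4 r (r + 1), ∀ i ∈ s,
      |F' b i (Lc ^ m) w| ≤ R' i / ((r : ℝ) + 1) ^ (P i).a * Real.exp (-(δ / ((Lc ^ m : ℕ) : ℝ)) * ((r : ℝ) + 1)))
    (hGtail : ∀ m : ℕ, 1 ≤ m → ∀ b ∈ Bset (Lc ^ m), ∀ r : ℕ, M (Lc ^ m) ≤ r → ∀ w ∈ annulus 4 r (r + 1), ∀ i ∈ s,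
      |G' b i (Lc ^ m) w| ≤ S' i / ((r : ℝ) + 1) ^ (Q i).a)
    (hident : ∀ m : ℕ, 1 ≤ m → ∃ R₀ : ℕ, M (Lc ^ m) ≤ R₀ ∧
      |composedCoeff μC m - ∑ b ∈ Bset (Lc ^ m), wt (Lc ^ m) b * ∑ w ∈ annulus 4 0 R₀, toReal w μ * toReal w ν *
        ∑ i ∈ s, cc₀ i * (F' b i (Lc ^ m) w * G' b i (Lc ^ m) w)| ≤ U)
    (hid : IdentityForm μC S.β0)
    {rr γ₀ β' : ℝ} (hγ₀ : 0 < γ₀) (hrem : RemainderConst S γ₀ rr) (hr : rr ≤ B12Normalization.stepBal N Lc)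
    (hβ' : 0 ≤ β') (hcont : BetaContH γ₀ β) (hup : BetaUpperH β' γ₀ β) : EndpointExistence Cn :=
  endpointExistence_of_drift_remainderConst hgen S hγ₀
    (oneLoopDrift_of_composedLegInterfacePow_identity_avg S hdeg hμν hN hval hL hwt0 hwt1 hR hS hR' hS' hδ hc hM hML hF hG
      hFtail hGtail hident hid)
    hrem hr hβ' hcont hup

end Avg

end Literature.MathematicalPhysics.QuantumFieldTheory.Balaban1983to89.Beta.ComposedRoad
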